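import Literature.MathematicalPhysics.QuantumFieldTheory.Balaban1983to89.B8Prop5JoinSectELocalRDRec
import Literature.MathematicalPhysics.QuantumFieldTheory.Balaban1983to89.B8Prop5SocketDatumRec
import Literature.MathematicalPhysics.QuantumFieldTheory.Balaban1983to89.B8Eq142KLevelLocalGammaRec
import Literature.MathematicalPhysics.QuantumFieldTheory.Balaban1983to89.B8Thm4KLevelGammaRec
import Literature.MathematicalPhysics.QuantumFieldTheory.Balaban1983to89.B8SockHFP59Gamma
import Literature.MathematicalPhysics.QuantumFieldTheory.Balaban1983to89.B8SockHFPRD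

/-!
# `Balaban1983to89.B8SockHFPRec` — RECORD TWIN of the two Prop-5 SOCKET BODIES the dented crown consumes: `B8SockHFP59Gamma` §1–§2 (the level-`m` step body with Theorem 4's own
# (1.59) clause, edition γ: `grad_bound_of_datum59_γ`, `sockHFP_body_of_join_59_γ`) and `B8SockHFPRD` §2 (the base body `sockHFP₀_body_of_join_RD`) ([Balaban1985RegularSpaces]
# Prop. 5 p. 94, Thm 4 p. 88, (1.66)–(1.69) p. 88, p. 89) FOR THE SYMMETRISED CENTRED block averaging (0.4) of [Balaban1987RG1]

statement-level skeleton of published theorems with citation tags; proofs where landed; nothing here is a claim about the Yang–Mills mass gap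

T. Bałaban, *Spaces of regular gauge field configurations on a lattice and gauge fixing conditions*, Commun. Math. Phys. **99** (1985) 75–102
`[Balaban1985RegularSpaces]` ("[6]"): Prop. 5 (1.106)–(1.109) p. 94, Thm 4 p. 88, Prop. 3 p. 87, (1.31) p. 82, (1.55)–(1.62) pp. 86–87, (1.66)–(1.69) p. 88, p. 89, (1.92)–(1.103) pp. 92–93;
T. Bałaban, *Propagators for lattice gauge theories in a background field*, Commun. Math. Phys. **99** (1985) 389–434 `[Balaban1985BackgroundPropagators]` ("[4]"): Thm 3.1 p. 397,
(3.16)–(3.25) pp. 393–394, Thm 3.3 p. 398; T. Bałaban, *Averaging operations for lattice gauge theories*, Commun. Math. Phys. **98** (1985) 17–51 `[Balaban1985Averaging]` ("[3]"):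
Prop. 10 p. 50; T. Bałaban, *Renormalization group approach to lattice gauge field theories. I*, Commun. Math. Phys. **109** (1987) 249–301 `[Balaban1987RG1]` ("[I]"): (0.3)–(0.4)
pp. 252–253.  STATUS: published, refereed.

CITATION HEADER (lean-in-tree rule).  Cell `pub-ymgap`, «N05-REC» stage 2 (director-ym №254∕№255∕№288), item R6 (f) SOCKETS for the record crown (desk `R6-PLAN.md` §5) — typed by the LEAD PEN
dag-n05-e g39 (inventory `N05-REC-INVENTORY.md` §R6 rows `B8SockHFP59Gamma`: A `sockHFP_body_of_join_59_γ`, `grad_bound_of_datum59_γ`; `B8SockHFPRD`: A `sockHFP₀_body_of_join_RD`).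
WHAT IS REPRODUCED = ✓ those three theorems (seat `pub-ymgap-dag-n05-e` g4–g10 lineage) VERBATIM under the token map, ONE file for the two socket bodies (D-0064 (4)); the engine's
family-wide wrappers (`B8SockHFPRD` §1 ∕ §3 ∕ §4) are off the crown's cone and not twinned.  THEOREM NAMES = the engine's (namespace `…B8SockHFPRec`).  TOKEN MAP: `avgIter ∕ linCovIter ∕
logCovIter ∕ InAx ∕ Restr129 ∕ IsLandau138W ∕ QT ∕ QprimeIter (zdBlocking) (bgT) ∕ blockSites ↦ avgIterZ ∕ linCovIterZ ∕ logCovIterZ ∕ InAxZ ∕ Restr129Z ∕ IsLandau138WZ ∕ QTZ ∕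
QprimeIter (zdBlockingZ) (bgTZ) ∕ blockSitesZ`; tower `B8Ineq130.tlo ∕ thi ↦ B8Ineq130Rec.tlo ∕ thi`, the datum-bond locality box `[loK, bondHiK] ↦ [Lʲz − c_j𝟙, Lʲz + Lʲe_μ + c_j𝟙]` and
the block `[L•z, L•z + blockTop] ↦ [L•z − s𝟙, L•z + s𝟙]` (CENTRED, as in dag-n05-c's `B8Eq142KLevelLocalGammaRec` ∕ g38's `B8Thm4KLevelGammaRec`); regime `(hL : 2 ≤ L) ↦
(hLs : L = 2sL+1) (hs1 : 1 ≤ sL)`, `C0 ↦ C0Z`; the gauge-fixing witness constant `40d·c_B ↦ 20dKZ·c_B` and ALL [3]-Prop-4 ∕ Props-8–9 windows in the record form (`exp(4c_Z·)(1 +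
2·131072(d+1)²KZ²·) ≤ 2`, `KZ· ≤ c₃`, `1024·d·KZ·c_B ≤ 1`), the (1.61) remainder constant in the record form `(1 + 2g_Z)(2·131072(d+1)²KZ²)e^{4c_ZL²α₀}L²` (from
`B8Thm4KLevelGammaRec.norm_B1_lt_kLevel_γ`).  Record inputs: `B8Prop5JoinSectELocalRDRec.hFP_kLevel_of_sectE_local'_RD`, `B8Prop5SocketDatumRec.restr129Z_succ_of_truncation ∕ inAxZ_congr_of_towers` (+ §0: the tower-reading datum binders twinned privately here),
`B8Thm4TruncationLocalRec.restr129Z_one`, `B8Eq142KLevelLocalGammaRec.H42_of_inAx_γ`, `B8Thm4KLevelGammaRec.norm_B1_lt_kLevel_γ`, `B8Eq119TwistedAxialRec.restr129Z_level_zero`,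
`B7SectEFLinearisationRec.linCovIterZ_zero`; structure-free engine inputs REUSED BY NAME (`B8Prop5SocketDatum` §2–§4 ∕ §6, `B8SockHFPAssembly` §0, `B8Prop3KLevelBdry.apriori_160_bdry ∕
apriori_162_bdry`, `B8Prop3KLevel.bound_of_sideTouches`, `B8Eq155KLevelLocal.eq155_norm_kLevel_hermitian`, `B8ScaledSupNorm.*`, `B8Eq155JBound.*`).  Kind «kernel-checked proof»,
theorems only; no `def`, no `instance`, no `notation`, no existing module modified.  `--supports stmt-QuantumFields-20541` (K0⁷-keyed, COUNT-NEUTRAL).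

## WHAT IS CERTIFIED HERE (kernel; axioms `propext` ∕ `Classical.choice` ∕ `Quot.sound`)
* §1 `grad_bound_of_datum59_γ` — (1.69) from (1.67)–(1.68) by Proposition 3 at level `m` with the TWO (1.59) members of the datum (edition β∕γ), record structure.
* §2 `sockHFP_body_of_join_59_γ` — the ∃λ-body of the record `SockHFP` at the level-`m` datum from the record JOIN, the datum dictionary and the (1.59) clause.
* §3 `sockHFP₀_body_of_join_RD` — the same at the base datum `u₁ = 1`, `U₁ = U′` (p. 89), record structure.

HONEST SCOPE: the engine's proofs verbatim under the token map; nothing of Bałaban's analysis newly proved; every LAW of [4]'s letters stays displayed as in the engine; `HThm4Rec`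
UNDISCHARGED; caveat (C-S3-1) + addendum v4 stand; N05 [B8] DISCHARGED OF RECORD untouched; N05 ∕ N07 NOT discharged; COUNT of record unmoved · K numerically unchanged; one finite `𝕋⁴`
programme at fixed `ε`, Bałaban AS PRINTED; nothing continuum ∕ ℝ⁴ ∕ OS ∕ mass-gap ∕ Clay.  No `sorry`, no `def`.

[cite: Balaban1985RegularSpaces, Prop. 5 (1.106)–(1.109) p.94, Theorem 4 p.88, Prop. 3 p.87, (1.31) p.82, (1.55)–(1.62) pp.86–87, (1.66)–(1.69) p.88, p.89, (1.92)–(1.103) pp.92–93;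
Balaban1985BackgroundPropagators, Theorem 3.1 p.397, (3.16)–(3.25) pp.393–394, Theorem 3.3 p.398; Balaban1985Averaging, Proposition 10 p.50; Balaban1987RG1, (0.3)–(0.4) pp.252–253]
-/

noncomputable section

open NormedSpace
open scoped BigOperators

namespace Literature.MathematicalPhysics.QuantumFieldTheory.Balaban1983to89.B8SockHFPRec

open Complex (I)
open B7Prop1Explicit B7Prop2Explicit B7Prop1Local B7Eq92Concrete
open B7Prop2Explicit (c2')
open B7Prop2Rec (AvgClosedZ C0Z avgClosedZ_unitaryUnits)
open B7Prop4GeneralLevelsRec (cZ gZ KZ gZ_nonneg)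
open B7Prop3Flat (c3)
open B7Prop10General (C6 C4G)
open B7Prop9Flat (C5')
open B7Eq78Linearization (conjR QprimeIter)
open B8Ineq132 (covDerivFwd covDeriv InAk BondTouches)
open B8Eq119TwistedAxialRec (Restr129Z InAxZ)
open B7SectEFLinearisationRec (zdBlockingZ bgTZ blockSitesZ linCovIterZ logCovIterZ)
open BlockAveragingZd (avgIterZ)
open B8Eq184Proof (gaugeExp cfgExp)
open B8Eq182Proof (gAd)
open B8Eq188Proof (frakF3)
open B8Lemma1NonAbelian (mulCfg)
open B8Eq140Level (SideTouches sideTouches_mono)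
open B8Eq146AExpansion (iEta expCfg)
open B8Ineq130Rec (tlo thi)
open B8Eq138LandauZd (covDivB covLap logCfg)
open B8Eq138LandauZdRec (IsLandau138WZ QTZ)
open B8Ineq159FlatMaps (logCfg_eq_of_cfgExp)
open B8Ineq125Concrete (C2p)
open B8Eq1117Concrete (XSpace)
open B8Eq155JBound (Jcur wsup expCfg_iEta_mem_unitaryUnits)
open B8ScaledSupNorm (bondNorm msup weight Bdd)
open B8Prop3GaugeFixedKLevel (expCfg_iEta_eq_cfgExp mem_unitaryUnits_of_mgauge_eq mulCfg_eq_gaugeAct_of_mgauge_eq inAk_congr_of_sideTouches)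
open B8Prop5ContractionKLevel (Bd2 Mc Kc)
open B8LambdaSpaceKLevel (wt)
open B8Prop5SocketDatum (exists_masked_datum grad_bound_trivial bd2_covDivB_of_grad sideTouches_pair_of_mem hA_of_datum)
open B8Prop5SocketDatumRec (restr129Z_succ_of_truncation)
open B8Prop5SocketDatumRec (inAxZ_congr_of_towers)
open B8Prop5JoinSectELocalRDRec (hFP_kLevel_of_sectE_local'_RD)
open B8SockHFPAssembly (isSelfAdjoint_covDivB covDivB_congr_at frakF3_congr_at mgauge_one_eq)
open B9SupplySockB9P3ZdBeta (CrossB)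
open BlockAveragingZd (ctrShift)
open B8Lemma1NonAbelianRecLoops (halfVec)

-- `Site` alone could resolve to the torus sites of `Setup.lean`; re-export the `ℤ^d` sites of `B7Prop1Explicit`.
export B7Prop1Explicit (Site)

variable {d : ℕ}

/-! ## §0 The TOWER-reading datum binders of the Prop-5 join on the CENTRED towers (private twins of `B8Prop5SocketDatum` §6∕§7, `B8Thm4AtLandau138.pdevOn_tower_lt_of_inAk`;
the public `inAx_mgauge_expCfg_of_datum` twins `B8SockHFPAssembly` §0 for `InAxZ`) -/

section Datum

variable {𝔸 : Type*} [CStarAlgebra 𝔸] [Nontrivial 𝔸]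
variable {L k : ℕ} {η : ℝ} {Ω : ℕ → Set (Site d)}

omit [Nontrivial 𝔸] in
/-- **(1.33) ON A CENTRED TOWER FROM THE CLASS `𝔄_k({Ω_j}, α)`** (twin of `B8Thm4AtLandau138.pdevOn_tower_lt_of_inAk` for `B8Ineq130Rec.tlo ∕ thi`): if the centred tower
`Bʲ(y)` lies in `Ω_j`, every plaquette based in it is an `Ω_j`-plaquette, so `pdevOn (tlo L y j) (thi L y j) U < α·L^{−2j}`. [cite: Balaban1985RegularSpaces, (1.7) p.77, (1.33) p.82; Balaban1987RG1, (0.3) p.252] -/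
private theorem pdevOn_tower_lt_of_inAk (hL1 : 1 ≤ L) {α : ℝ} (hα : 0 < α) {U : Site d → Fin d → 𝔸ˣ} (hA : InAk L k η α Ω U)
    {j : ℕ} (hj : j ≤ k) {y : Site d} (hy : ∀ x, InBox (tlo L y j) (thi L y j) x → x ∈ Ω j) :
    pdevOn (tlo L y j) (thi L y j) U < α * (((L : ℝ) ^ j)⁻¹) ^ 2 := by
  have hL0 : 0 < L := hL1
  refine B8Ineq132.pdevOn_lt_of_forall (by positivity) fun x μ ν hx _ => ?_
  rcases eq_or_ne μ ν with rfl | hμν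
  · rw [hol_plaqWord_self, Units.val_one, sub_self, norm_zero]; positivity
  · exact (hA j hj).1 x μ ν hμν (Or.inl (hy x hx))

/-- For `d ≥ 2`, a bond with both end-points in a tower `Bʲ(y) ⊂ Ω_j` is a side of a plaquette touching `Ω_j` (the JOIN's `hEbT`).
[cite: Balaban1985RegularSpaces, p.77 (convention before (1.5)), (1.6) p.77] -/
private theorem sideTouches_of_tower_bond (hd2 : 2 ≤ d) {L k : ℕ} {Ω : ℕ → Set (Site d)} {Λs : ℕ → Set (Site d)}
    (htower : ∀ j, j ≤ k → ∀ y ∈ Λs j, ∀ x, InBox (tlo L y j) (thi L y j) x → x ∈ Ω j)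
    {j : ℕ} (hj : j ≤ k) {y : Site d} (hy : y ∈ Λs j) (x : Site d) (κ : Fin d) (hx : InBox (tlo L y j) (thi L y j) x) :
    SideTouches (Ω j) x κ :=
  (sideTouches_pair_of_mem hd2 (htower j hj y hy x hx) κ).1


omit [Nontrivial 𝔸] in
/-- **JOIN's `h33`** (plaquette regularity of the background on the towers of `Λs (m+1)`): from (1.33) `U₀ ∈ 𝔄_K({Ω_j}, α₀)` and
«`Bʲ(y) ⊂ Ω_j`». [cite: Balaban1985RegularSpaces, (1.7) p.77, (1.33) p.82] -/
private theorem h33_of_inAk {L : ℕ} (hL : 1 ≤ L) {K : ℕ} {η α₀ : ℝ} (hα₀ : 0 < α₀) {Ω : ℕ → Set (Site d)} {U₀ : Site d → Fin d → 𝔸ˣ}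
    (h33 : InAk L K η α₀ Ω U₀) {m : ℕ} (hmK : m + 1 ≤ K) {Λ : ℕ → Set (Site d)}
    (htower : ∀ j, j ≤ m + 1 → ∀ y ∈ Λ j, ∀ x, InBox (tlo L y j) (thi L y j) x → x ∈ Ω j) :
    ∀ j, j ≤ m + 1 → ∀ y ∈ Λ j, pdevOn (tlo L y j) (thi L y j) U₀ < α₀ * (((L : ℝ) ^ j)⁻¹) ^ 2 :=
  fun j hj y hy => pdevOn_tower_lt_of_inAk hL hα₀ h33 (hj.trans hmK) (htower j hj y hy)

/-- **JOIN's `hP`** (plaquette regularity of `e^{iηA′}U₀` on the towers, `αP := α₀`): `U₁U₀ = (U′U₀)^{u₁⁻¹} ∈ 𝔄` by gauge invariance,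
`e^{iηA′} = U₁` on the sides of the plaquettes touching `Ω_j` for every `j ≤ m + 1` (those of `Ω_{m+1}` touch `Ω_m`), locality of `𝔄`.
[cite: Balaban1985RegularSpaces, (1.7) p.77, (1.11) p.77 (gauge invariance), (1.34) p.82, (1.69) p.88] -/
private theorem hP_of_datum {L : ℕ} (hL : 1 ≤ L) {K : ℕ} {η α₀ : ℝ} (hα₀ : 0 < α₀) {Ω : ℕ → Set (Site d)} (hΩ : ∀ j, Ω (j + 1) ⊆ Ω j)
    {U₀ U' : Site d → Fin d → 𝔸ˣ} (h34 : InAk L K η α₀ Ω (mulCfg U' U₀)) {m : ℕ} (hmK : m + 1 ≤ K) {Λ : ℕ → Set (Site d)}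
    (htower : ∀ j, j ≤ m + 1 → ∀ y ∈ Λ j, ∀ x, InBox (tlo L y j) (thi L y j) x → x ∈ Ω j)
    {u₁ : Site d → 𝔸ˣ} {U₁ : Site d → Fin d → 𝔸ˣ} {A' : Site d → Fin d → 𝔸} (hu₁ : ∀ x, u₁ x ∈ unitaryUnits 𝔸)
    (hW : mgauge U₀ u₁ U₁ = U') (hWA : ∀ j, j ≤ m → ∀ (y : Site d) (τ : Fin d), SideTouches (Ω j) y τ → U₁ y τ = cfgExp η A' y τ) :
    ∀ j, j ≤ m + 1 → ∀ y ∈ Λ j,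
      pdevOn (tlo L y j) (thi L y j) (expCfg (iEta η A') * U₀) < α₀ * (((L : ℝ) ^ j)⁻¹) ^ 2 := by
  have h34W : InAk L (m + 1) η α₀ Ω (mulCfg U₁ U₀) := by
    have h1 : InAk L (m + 1) η α₀ Ω (mulCfg U' U₀) := fun j hj => h34 j (hj.trans hmK)
    have hui : ∀ x, u₁⁻¹ x ∈ U1 𝔸 := fun x => unitaryUnits_le_U1 ((unitaryUnits 𝔸).inv_mem (hu₁ x))
    rw [mulCfg_eq_gaugeAct_of_mgauge_eq hW]
    exact (B8Ineq132.inAk_gaugeAct_iff L (m + 1) η α₀ Ω hui _).2 h1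
  -- `e^{iηA′} = U₁` on the sides of the plaquettes touching `Ω_j`, `j ≤ m + 1`
  have hagree : ∀ j, j ≤ m + 1 → ∀ (y : Site d) (τ : Fin d), SideTouches (Ω j) y τ →
      mulCfg U₁ U₀ y τ = mulCfg (expCfg (iEta η A')) U₀ y τ := by
    intro j hj y τ hs
    have hs' : ∃ j', j' ≤ m ∧ SideTouches (Ω j') y τ := by
      rcases Nat.lt_or_ge j (m + 1) with hjm | hjm
      · exact ⟨j, by omega, hs⟩
      · obtain rfl : j = m + 1 := le_antisymm hj hjm
        exact ⟨m, le_rfl, B8Eq140Level.sideTouches_mono (hΩ m) hs⟩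
    obtain ⟨j', hj', hs''⟩ := hs'
    show U₁ y τ * U₀ y τ = expCfg (iEta η A') y τ * U₀ y τ
    rw [hWA j' hj' y τ hs'', expCfg_iEta_eq_cfgExp]
  have h40₁ : InAk L (m + 1) η α₀ Ω (mulCfg (expCfg (iEta η A')) U₀) :=
    (inAk_congr_of_sideTouches L (m + 1) η α₀ (V := mulCfg U₁ U₀) hagree).1 h34W
  intro j hj y hy
  exact pdevOn_tower_lt_of_inAk hL hα₀ h40₁ hj (htower j hj y hy)

omit [Nontrivial 𝔸] in
/-- **JOIN's `h69`** (the exponent `B = iηA′` on the tower bonds, `cB := L·c⋆`): `‖iηA′(x, κ)‖ ≤ L·c·(Lʲ)⁻¹` for every bond with both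
end-points in a tower `Bʲ(y) ⊂ Ω_j`, `y ∈ Λs (m+1) j`, `j ≤ m + 1`, from `‖A′‖ ≤ c(Lʲ′η)⁻¹` on the sides of the plaquettes touching `Ω_j′`,
`j′ ≤ m` (for `j = m + 1` through `Ω_{m+1} ⊂ Ω_m`: `c(L^m)⁻¹ = L·c·(L^{m+1})⁻¹`). [cite: Balaban1985RegularSpaces, (1.69) p.88] -/
private theorem h69_of_datum (hd2 : 2 ≤ d) {L : ℕ} (hL : 1 ≤ L) {η : ℝ} (hη : 0 < η) {Ω : ℕ → Set (Site d)} (hΩ : ∀ j, Ω (j + 1) ⊆ Ω j)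
    {m : ℕ} {Λ : ℕ → Set (Site d)} (htower : ∀ j, j ≤ m + 1 → ∀ y ∈ Λ j, ∀ x, InBox (tlo L y j) (thi L y j) x → x ∈ Ω j)
    {A' : Site d → Fin d → 𝔸} {c : ℝ} (hc : 0 ≤ c)
    (h41 : ∀ j, j ≤ m → ∀ (y : Site d) (τ : Fin d), SideTouches (Ω j) y τ → ‖A' y τ‖ ≤ c * ((L : ℝ) ^ j * η)⁻¹) :
    ∀ j, j ≤ m + 1 → ∀ y ∈ Λ j, ∀ (x : Site d) (κ : Fin d), InBox (tlo L y j) (thi L y j) x →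
      InBox (tlo L y j) (thi L y j) (x + e κ) → ‖iEta η A' x κ‖ ≤ (L * c) * ((L : ℝ) ^ j)⁻¹ := by
  have hLr : (1 : ℝ) ≤ L := by exact_mod_cast hL
  intro j hj y hy x κ hx _
  have hxΩ : x ∈ Ω j := htower j hj y hy x hx
  -- the norm of `iηA′`
  have hnorm : ‖iEta η A' x κ‖ = η * ‖A' x κ‖ := by
    show ‖((I : ℂ) * η) • A' x κ‖ = η * ‖A' x κ‖
    rw [norm_smul, norm_mul, Complex.norm_I, one_mul, Complex.norm_real, Real.norm_eq_abs, abs_of_pos hη]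
  rw [hnorm]
  rcases Nat.lt_or_ge j (m + 1) with hjm | hjm
  · -- `j ≤ m`: the bond touches `Ω_j`
    have hs : SideTouches (Ω j) x κ := (sideTouches_pair_of_mem hd2 hxΩ κ).1
    have hb := h41 j (by omega) x κ hs
    have hLj : (0 : ℝ) < (L : ℝ) ^ j := by positivity
    calc η * ‖A' x κ‖ ≤ η * (c * ((L : ℝ) ^ j * η)⁻¹) := mul_le_mul_of_nonneg_left hb hη.le
      _ = c * ((L : ℝ) ^ j)⁻¹ := by field_simp
      _ ≤ L * c * ((L : ℝ) ^ j)⁻¹ := by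
          have : c ≤ L * c := le_mul_of_one_le_left hc hLr
          exact mul_le_mul_of_nonneg_right this (by positivity)
  · -- `j = m + 1`: the bond touches `Ω_m ⊃ Ω_{m+1}`
    obtain rfl : j = m + 1 := le_antisymm hj hjm
    have hs : SideTouches (Ω m) x κ := (sideTouches_pair_of_mem hd2 (hΩ m hxΩ) κ).1
    have hb := h41 m le_rfl x κ hs
    calc η * ‖A' x κ‖ ≤ η * (c * ((L : ℝ) ^ m * η)⁻¹) := mul_le_mul_of_nonneg_left hb hη.le
      _ = c * ((L : ℝ) ^ m)⁻¹ := by field_simp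
      _ = L * c * ((L : ℝ) ^ (m + 1))⁻¹ := by rw [pow_succ]; field_simp

omit [Nontrivial 𝔸] in
/-- **The JOIN's `hAx` from the datum**: the block axial gauge (1.19)/(1.34) of `U′U₀` relative to `U₀` at the truncation `m + 1` transfers to
`(e^{iηA′})^{u₁}·U₀` — the two agree on every bond of every tower `Bʲ(y) ⊂ Ω_j`, `y ∈ Λ_j`, `j ≤ m + 1` (`U′ = U₁^{u₁}`, `U₁ = e^{iηA′}` on the sides of
the plaquettes touching `Ω_{j′}`, `j′ ≤ m`, and `Ω_{m+1} ⊂ Ω_m`), and `Ax` reads the towers only (`B8Prop5SocketDatum.inAx_congr_of_towers`).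
[cite: Balaban1985RegularSpaces, (1.19)–(1.20) p.79, (1.34) p.82, (1.69) p.88] -/
theorem inAx_mgauge_expCfg_of_datum (hd2 : 2 ≤ d) {L sL : ℕ} (hLs : L = 2 * sL + 1) {η : ℝ} {Ω : ℕ → Set (Site d)} (hΩ : ∀ j, Ω (j + 1) ⊆ Ω j)
    {m : ℕ} {Λ : ℕ → Set (Site d)} (htower : ∀ j, j ≤ m + 1 → ∀ y ∈ Λ j, ∀ x, InBox (tlo L y j) (thi L y j) x → x ∈ Ω j)
    {U₀ U' U₁ : Site d → Fin d → 𝔸ˣ} {u₁ : Site d → 𝔸ˣ} {A' : Site d → Fin d → 𝔸} (hW : mgauge U₀ u₁ U₁ = U')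
    (hWA : ∀ j, j ≤ m → ∀ (y : Site d) (τ : Fin d), SideTouches (Ω j) y τ → U₁ y τ = cfgExp η A' y τ)
    (hAx : InAxZ L (m + 1) Λ U₀ (mulCfg U' U₀)) : InAxZ L (m + 1) Λ U₀ (mgauge U₀ u₁ (expCfg (iEta η A')) * U₀) := by
  refine (inAxZ_congr_of_towers hLs (m + 1) Λ U₀ (mulCfg U' U₀) _ fun j _ hj y hy x κ hx _ => ?_).1 hAx
  -- the bond `⟨x, x + e_κ⟩` starts in the tower `⊂ Ω_j`: a side touching `Ω_j` (`j ≤ m`) or `Ω_m ⊃ Ω_{m+1}` (`j = m + 1`)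
  have hs : ∃ j', j' ≤ m ∧ SideTouches (Ω j') x κ := by
    have hs0 : SideTouches (Ω j) x κ := sideTouches_of_tower_bond hd2 htower hj hy x κ hx
    rcases Nat.lt_or_ge j (m + 1) with hjm | hjm
    · exact ⟨j, by omega, hs0⟩
    · obtain rfl : j = m + 1 := le_antisymm hj hjm
      exact ⟨m, le_rfl, sideTouches_mono (hΩ m) hs0⟩
  obtain ⟨j', hj', hs'⟩ := hs
  show U' x κ * U₀ x κ = mgauge U₀ u₁ (expCfg (iEta η A')) x κ * U₀ x κ
  rw [← hW, mgauge_apply, mgauge_apply, hWA j' hj' x κ hs', expCfg_iEta_eq_cfgExp]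

end Datum

/-! ## §1 (1.69) from (1.67)–(1.68) by Proposition 3 at level `m`, the TWO (1.59) members of the datum in EDITION β -/
section Grad

variable {𝔸 : Type*} [CStarAlgebra 𝔸] [Nontrivial 𝔸]

/-- ★ **(1.69) FROM (1.67)–(1.68) BY PROPOSITION 3 AT LEVEL `m ≥ 1`, THE (1.59) INPUT AS TWO MEMBERS FOR THE DATUM, EDITION γ** — g8's
`B8SockHFP59BdryBeta.grad_bound_of_datum59_bdryβ` (p552062) with the datum class `Λb` under PRINT's box law «box ⊂ Ω_{j−1}» (`hbox`), the datum's (1.35) asked in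
the same guard (`h135`), [3] Prop. 4's windows one level lower (`(L²α₀, L·α₂)`) and the γ remainder constant in (1.61); the two (1.59) members `h59a`, `h59g` keep
the β-shaped index `Λb m j ∪ {level-0 crossing bonds of Ω₀}` and the exterior-collar allowance.  SAME conclusion `(Lʲη)²|(∇^η_{U₀,κ}A′_τ)(y)| ≤ 5dLB₀(α₀ + α₁)`.
PROOF: as there — Proposition 3 assembled inline (`eq155_norm_kLevel_hermitian`, `apriori_160_bdry`, `apriori_162_bdry`) with «|B₁| < 2dLα₁ + C₂α₂²» proved
pointwise: on the class `Λb m j` (inner AND crossing bonds at every level) by `H42_of_inAx_γ` + `norm_B1_lt_kLevel_γ`; on a level-0 crossing bond of `Ω₀` carried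
by the index's `CrossB` disjunct `Q₀ = 1` and `u₁ = 1` at both end-points (support clause outside, `hlay` + (1.29)₀ inside), so the term is `η‖A′(b)‖ ≤ 2‖U′(b) − 1‖ ≤
2α₁ ≤ 2dLα₁` by (1.66)₀ — same constant, no new window.
[cite: Balaban1985RegularSpaces, (1.66)–(1.69) p.88, Prop. 3 p.87, (1.40)–(1.42) p.83, (1.58)–(1.62) pp.86–87, (1.29) p.81, (1.31) p.82, Prop. 5 p.94, p.77; Balaban1984PropagatorsII, (2.3) p.224] -/
theorem grad_bound_of_datum59_γ (hd2 : 2 ≤ d) {η : ℝ} (hη : 0 < η) {L sL : ℕ} (hLs : L = 2 * sL + 1) (hs1 : 1 ≤ sL) (K : ℕ)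
    {U₀ U' : Site d → Fin d → 𝔸ˣ} (hU₀ : ∀ x κ, U₀ x κ ∈ unitaryUnits 𝔸) (hU' : ∀ x κ, U' x κ ∈ unitaryUnits 𝔸)
    {α₀ α₁ α₂ B₀ C₂ : ℝ} (hα₀ : 0 < α₀) (hα₁ : 0 < α₁) (hα₂ : 0 < α₂) (hB₀ : 0 ≤ B₀)
    -- Prop. 3's windows: [3] Prop. 4's ONE LEVEL LOWER, at `(L²α₀, L·α₂)` (edition γ: the box of a level-`j` datum bond lies in `Ω_{j−1}`),
    -- the level-`m` bootstrap's at `α₂`, (1.61) with the γ remainder constant, and `dLα₁ ≤ 1/8`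
    (hα3 : C0Z d * ((L : ℝ) ^ 2 * α₀) ≤ 1 / 3) (hα4 : 4 * ((L : ℝ) ^ 2 * α₀) ≤ c2' d L) (h16 : 16 * ((L : ℝ) * α₂) ≤ 1)
    (hd5 : 5 * α₂ * ((d : ℝ) - 1) ≤ 4)
    (hsmall : Real.exp (4 * cZ d * ((L : ℝ) ^ 2 * α₀)) * (1 + 2 * (131072 * ((d : ℝ) + 1) ^ 2) * (KZ d L) ^ 2 * ((L : ℝ) * α₂)) ≤ 2)
    (hc₃ : KZ d L * ((L : ℝ) * α₂) ≤ c3 d L) (hside : 36 * d * B₀ * α₂ ≤ 1 / 2) (h50 : 50 * d * α₂ ≤ 1)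
    (hC₂ : (1 + 2 * gZ d L) * (2 * (131072 * ((d : ℝ) + 1) ^ 2) * (KZ d L) ^ 2) * Real.exp (4 * cZ d * ((L : ℝ) ^ 2 * α₀)) * (L : ℝ) ^ 2 ≤ C₂)
    (h61 : 2 * α₂ ^ 2 + 20 * d * α₀ * α₂ + 2 * C₂ * α₂ ^ 2 ≤ α₀ + α₁) (hsmall₁ : (d : ℝ) * L * α₁ ≤ 1 / 8)
    -- the member's geometry
    (Ω : ℕ → Set (Site d)) (hΩ : ∀ j, Ω (j + 1) ⊆ Ω j) (Λs : ℕ → ℕ → Set (Site d)) (Λb : ℕ → ℕ → Set (Site d × Fin d))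
    -- PRINT's box law (edition γ): the locality box of a level-`j` datum bond lies in `Ω_{j−1}` ((1.31); level 0: `Ω₀`)
    (hbox : ∀ m, m ≤ K → ∀ j, j ≤ m → ∀ c ∈ Λb m j, ∀ x, InBox (fun i => (L : ℤ) ^ j * c.1 i - (ctrShift L j : ℤ)) (fun i => (L : ℤ) ^ j * c.1 i + (ctrShift L j : ℤ) + if i = c.2 then (L : ℤ) ^ j else 0) x → x ∈ Ω (j - 1))
    (hclass : ∀ m, m ≤ K → ∀ j, j ≤ m → ∀ c ∈ Λb m j,
      (c.1 ∈ Λs m j ∧ c.1 + e c.2 ∈ Λs m j) ∨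
      (∃ j', j = j' + 1 ∧ (∀ x, (L : ℤ) • c.1 - halfVec L ≤ x → x ≤ (L : ℤ) • c.1 + halfVec L → x ∈ Λs m j') ∧ c.1 + e c.2 ∈ Λs m j) ∨
      (∃ j', j = j' + 1 ∧ c.1 ∈ Λs m j ∧ (∀ x, (L : ℤ) • (c.1 + e c.2) - halfVec L ≤ x → x ≤ (L : ℤ) • (c.1 + e c.2) + halfVec L → x ∈ Λs m j')))
    -- the socket's antecedents: (1.33), (1.34), (1.35)/(1.66)
    (h33 : InAk L K η α₀ Ω U₀) (h34 : InAk L K η α₀ Ω (mulCfg U' U₀)) (hAx : ∀ m, m ≤ K → InAxZ L m (Λs m) U₀ (mulCfg U' U₀))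
    -- (1.35) for the datum in PRINT's class: every level-`j` bond whose locality box lies in `Ω_{j−1}`
    (h135 : ∀ j, j ≤ K → ∀ (z : Site d) (μ : Fin d), (∀ x, InBox (fun i => (L : ℤ) ^ j * z i - (ctrShift L j : ℤ)) (fun i => (L : ℤ) ^ j * z i + (ctrShift L j : ℤ) + if i = μ then (L : ℤ) ^ j else 0) x → x ∈ Ω (j - 1)) →
      ‖(avgIterZ L (mulCfg U' U₀) j z μ : 𝔸) - (avgIterZ L U₀ j z μ : 𝔸)‖ ≤ α₁)
    -- (1.66)₀ on the sides touching `Ω₀` and the exterior-collar constant with its absorption window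
    (h66 : ∀ b ∈ {b : Site d × Fin d | SideTouches (Ω 0) b.1 b.2}, ‖((U' b.1 b.2 : 𝔸ˣ) : 𝔸) - 1‖ ≤ α₁)
    -- the boundary-layer law of the member's region (∂-layer sites of `Ω₀` lie in `Λs m 0`, `1 ≤ m ≤ K`)
    (hlay : ∀ m, 1 ≤ m → m ≤ K → ∀ y z : Site d, y ∈ Ω 0 → z ∉ Ω 0 → (∀ i, y i - 1 ≤ z i ∧ z i ≤ y i + 1) → y ∈ Λs m 0)
    {Bbd : ℝ} (hBbd : 0 ≤ Bbd) (hBd : 4 * Bbd ≤ ((d : ℝ) * L - 1) * B₀)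
    -- the level `m`
    {m : ℕ} (hm1 : 1 ≤ m) (hmK : m ≤ K)
    -- the datum at level `m`, with its masked exponent
    {u₁ : Site d → 𝔸ˣ} {U₁ : Site d → Fin d → 𝔸ˣ} {A' : Site d → Fin d → 𝔸}
    (hu₁ : ∀ x, u₁ x ∈ unitaryUnits 𝔸) (hu₁S : ∀ x, x ∉ Ω 0 → u₁ x = 1) (hW : mgauge U₀ u₁ U₁ = U')
    (h129 : Restr129Z L m (Λs m) U₀ u₁)
    (hLan : IsLandau138WZ L m η (Ω 0) (Λs m) U₀ U₁) (hsa : ∀ y τ, IsSelfAdjoint (A' y τ))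
    (hWA : ∀ j, j ≤ m → ∀ (y : Site d) (τ : Fin d), SideTouches (Ω j) y τ →
      U₁ y τ = cfgExp η A' y τ ∧ ‖A' y τ‖ ≤ α₂ * ((L : ℝ) ^ j * η)⁻¹)
    (hA0 : ∀ (y : Site d) (τ : Fin d), (∀ j, j ≤ m → ¬ SideTouches (Ω j) y τ) → A' y τ = 0)
    -- the TWO (1.59) members for THIS datum at background `U₀`, EACH WITH THE EXTERIOR-COLLAR ALLOWANCE `+ B_∂·Φ₀(A′)`
    (h59a : msup L m η (-(1 : ℝ)) (fun j (b : Site d × Fin d) => SideTouches (Ω j) b.1 b.2) (fun b => A' b.1 b.2)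
        ≤ B₀ * (bondNorm L m η (-(3 : ℝ)) Ω (fun x μ => Jcur η U₀ A' μ x)
          + wsup 1 (fun p : {p : ℕ × (Site d × Fin d) // p.1 ≤ m ∧ (p.2 ∈ Λb m p.1 ∨ (p.1 = 0 ∧ CrossB (Ω 0) p.2))} =>
              linCovIterZ L U₀ (iEta η A') p.1.1 p.1.2.1 p.1.2.2))
          + Bbd * msup L m η (-(1 : ℝ)) (fun j (b : Site d × Fin d) => j = 0 ∧ SideTouches (Ω 0) b.1 b.2 ∧ ¬ BondTouches (Ω 0) b.1 b.2)
              (fun b => A' b.1 b.2))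
    (h59g : msup L m η (-(2 : ℝ)) (fun j (t : Fin d × Fin d × Site d) => SideTouches (Ω j) t.2.2 t.2.1)
          (fun t => covDerivFwd η U₀ t.1 (fun z => A' z t.2.1) t.2.2)
        ≤ B₀ * (bondNorm L m η (-(3 : ℝ)) Ω (fun x μ => Jcur η U₀ A' μ x)
          + wsup 1 (fun p : {p : ℕ × (Site d × Fin d) // p.1 ≤ m ∧ (p.2 ∈ Λb m p.1 ∨ (p.1 = 0 ∧ CrossB (Ω 0) p.2))} =>
              linCovIterZ L U₀ (iEta η A') p.1.1 p.1.2.1 p.1.2.2))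
          + Bbd * msup L m η (-(1 : ℝ)) (fun j (b : Site d × Fin d) => j = 0 ∧ SideTouches (Ω 0) b.1 b.2 ∧ ¬ BondTouches (Ω 0) b.1 b.2)
              (fun b => A' b.1 b.2)) :
    ∀ j, j ≤ m → ∀ (y : Site d) (κ τ : Fin d), SideTouches (Ω j) y τ →
      ((L : ℝ) ^ j * η) ^ 2 * ‖covDerivFwd η U₀ κ (fun z => A' z τ) y‖ ≤ 5 * d * L * B₀ * (α₀ + α₁) := by
  have hL1 : 1 ≤ L := by omega
  have hd1 : 1 ≤ d := le_trans (by norm_num) hd2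
  have hLr : (1 : ℝ) ≤ L := by exact_mod_cast hL1
  -- the level-`m` windows at `α₂` follow from the γ windows at `L·α₂` (`L ≥ 1`)
  have hLα₂ : α₂ ≤ (L : ℝ) * α₂ := le_mul_of_one_le_left hα₂.le hLr
  have h16' : 16 * α₂ ≤ 1 := by linarith only [h16, hLα₂]
  have hU₀1 : ∀ x κ, U₀ x κ ∈ U1 𝔸 := fun x κ => unitaryUnits_le_U1 (hU₀ x κ)
  -- the datum is unitary-valued; its class (1.40)₁ by gauge invariance and locality
  have hWu : ∀ x κ, U₁ x κ ∈ unitaryUnits 𝔸 := mem_unitaryUnits_of_mgauge_eq hU₀ hU' hu₁ hW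
  have h33m : InAk L m η α₀ Ω U₀ := fun j hj => h33 j (hj.trans hmK)
  have h34W : InAk L m η α₀ Ω (mulCfg U₁ U₀) := by
    have h1 : InAk L m η α₀ Ω (mulCfg U' U₀) := fun j hj => h34 j (hj.trans hmK)
    have hui : ∀ x, u₁⁻¹ x ∈ U1 𝔸 := fun x => unitaryUnits_le_U1 ((unitaryUnits 𝔸).inv_mem (hu₁ x))
    rw [mulCfg_eq_gaugeAct_of_mgauge_eq hW]
    exact (B8Ineq132.inAk_gaugeAct_iff L m η α₀ Ω hui _).2 h1
  have h40₁ : InAk L m η α₀ Ω (mulCfg (expCfg (iEta η A')) U₀) := by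
    refine (inAk_congr_of_sideTouches L m η α₀ (V := mulCfg U₁ U₀) fun j hj y τ hs => ?_).1 h34W
    show U₁ y τ * U₀ y τ = expCfg (iEta η A') y τ * U₀ y τ
    rw [(hWA j hj y τ hs).1, expCfg_iEta_eq_cfgExp]
  have h41' : ∀ j, j ≤ m → ∀ (y : Site d) (τ : Fin d), SideTouches (Ω j) y τ → ‖A' y τ‖ ≤ α₂ * ((L : ℝ) ^ j * η)⁻¹ :=
    fun j hj y τ hs => (hWA j hj y τ hs).2
  -- the gradient datum (bounded family) and its supremum `g`
  have hgrad : ∀ (y : Site d) (κ τ : Fin d), ‖covDerivFwd η U₀ κ (fun z => A' z τ) y‖ ≤ 2 * α₂ * η⁻¹ * η⁻¹ := by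
    intro y κ τ
    have h := grad_bound_trivial hη hL1 hU₀ hα₂.le h41' hA0 y κ τ
    have hη2 : 0 < η ^ 2 := by positivity
    rw [show 2 * α₂ * η⁻¹ * η⁻¹ = 2 * α₂ / η ^ 2 by field_simp, le_div_iff₀ hη2, mul_comm]
    exact h
  have hBg : Bdd L m η (-(2 : ℝ)) (fun j (t : Fin d × Fin d × Site d) => SideTouches (Ω j) t.2.2 t.2.1)
      (fun t => covDerivFwd η U₀ t.1 (fun z => A' z t.2.1) t.2.2) := by
    have e2 : (-(2 : ℝ)) = -((2 : ℕ) : ℝ) := by norm_num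
    rw [e2]
    refine B8ScaledSupNorm.bdd_of_forall (c := 2 * α₂ * ((L : ℝ) ^ m) ^ 2) fun j hj t _ => ?_
    rw [B8ScaledSupNorm.weight_neg_natCast L η 2 j]
    have hLjm : (L : ℝ) ^ j ≤ (L : ℝ) ^ m := pow_le_pow_right₀ hLr hj
    have hLj0 : (0 : ℝ) ≤ (L : ℝ) ^ j := by positivity
    calc ((L : ℝ) ^ j * η) ^ 2 * ‖covDerivFwd η U₀ t.1 (fun z => A' z t.2.1) t.2.2‖
        ≤ ((L : ℝ) ^ j * η) ^ 2 * (2 * α₂ * η⁻¹ * η⁻¹) := mul_le_mul_of_nonneg_left (hgrad _ _ _) (by positivity)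
      _ = 2 * α₂ * ((L : ℝ) ^ j) ^ 2 := by field_simp
      _ ≤ 2 * α₂ * ((L : ℝ) ^ m) ^ 2 := by gcongr
  set g : ℝ := msup L m η (-(2 : ℝ)) (fun j (t : Fin d × Fin d × Site d) => SideTouches (Ω j) t.2.2 t.2.1)
      (fun t => covDerivFwd η U₀ t.1 (fun z => A' z t.2.1) t.2.2) with hg_def
  have hg0 : 0 ≤ g := B8ScaledSupNorm.msup_nonneg L m hη.le _ _ _
  have hg : ∀ j, j ≤ m → ∀ (y : Site d) (κ τ : Fin d), SideTouches (Ω j) y τ →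
      ((L : ℝ) ^ j * η) ^ 2 * ‖covDerivFwd η U₀ κ (fun z => A' z τ) y‖ ≤ g := by
    intro j hj y κ τ hs
    have h := B8ScaledSupNorm.weight_mul_norm_le_msup hBg hj (i := (κ, τ, y)) hs
    have hw : weight L η (-(2 : ℝ)) j = ((L : ℝ) ^ j * η) ^ 2 := by
      have e2 : (-(2 : ℝ)) = -((2 : ℕ) : ℝ) := by norm_num
      rw [e2, B8ScaledSupNorm.weight_neg_natCast L η 2 j]
    rw [hw] at h
    exact h
  -- (1.42)/(1.37) on the constraint bonds of the `m`-truncation, by the (1.42) lemma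
  -- (1.42) on PRINT's class of the `m`-truncation — inner AND crossing bonds at every level — by the γ (1.42) lemma
  have h42 : ∀ j, j ≤ m → ∀ c ∈ Λb m j, ‖logCovIterZ L U₀ (iEta η A') j c.1 c.2‖ < 2 * d * L * α₁ :=
    B8Eq142KLevelLocalGammaRec.H42_of_inAx_γ hd2 hη hLs hs1 K hU₀ hα₀ hα₁ hα₂.le hα3 hα4 hsmall hc₃ hsmall₁ Ω hΩ Λs Λb hbox hclass h33 h34
      hAx h135 (fun m W => IsLandau138WZ L m η (Ω 0) (Λs m) U₀ W) m hm1 hmK u₁ U₁ A' hu₁ hW h129 hLan hsa hWA hA0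
  have hboxm : ∀ j, j ≤ m → ∀ c ∈ Λb m j, ∀ x, InBox (fun i => (L : ℤ) ^ j * c.1 i - (ctrShift L j : ℤ)) (fun i => (L : ℤ) ^ j * c.1 i + (ctrShift L j : ℤ) + if i = c.2 then (L : ℤ) ^ j else 0) x → x ∈ Ω (j - 1) :=
    fun j hj c hc x hx => hbox m hmK j hj c hc x hx
  -- `u₁ = 1` AT BOTH END-POINTS OF A SIDE OF `Ω₀` NOT FULLY INSIDE `Ω₀` (outer end-points: support of `u₁`; an inner end-point with a neighbour outside
  -- is a boundary-layer site, in `Λs m 0` by `hlay`, where (1.29)₀ pins `u₁ = 1`), so `U₁ = U′` there and `η‖A′‖ = ‖log U′‖ ≤ 2‖U′ − 1‖ ≤ 2α₁`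
  have hdL : (1 : ℝ) ≤ (d : ℝ) * L := one_le_mul_of_one_le_of_one_le (by exact_mod_cast (le_trans (by norm_num) hd2 : 1 ≤ d)) hLr
  have hα₁4 : α₁ ≤ 1 / 4 := by
    have h1 : α₁ ≤ (d : ℝ) * L * α₁ := le_mul_of_one_le_left hα₁.le hdL
    linarith [h1, hsmall₁]
  have he1 : ∀ (b : Site d × Fin d) (i : Fin d), b.1 i - 1 ≤ (b.1 + e b.2) i ∧ (b.1 + e b.2) i ≤ b.1 i + 1 := by
    intro b i
    simp only [Pi.add_apply, e_apply]
    split_ifs <;> constructor <;> omega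
  have he2 : ∀ (b : Site d × Fin d) (i : Fin d), (b.1 + e b.2) i - 1 ≤ b.1 i ∧ b.1 i ≤ (b.1 + e b.2) i + 1 := by
    intro b i
    simp only [Pi.add_apply, e_apply]
    split_ifs <;> constructor <;> omega
  have hu1 : ∀ b : Site d × Fin d, ¬ (b.1 ∈ Ω 0 ∧ b.1 + e b.2 ∈ Ω 0) → u₁ b.1 = 1 ∧ u₁ (b.1 + e b.2) = 1 := by
    intro b hnb
    refine ⟨?_, ?_⟩
    · by_cases h : b.1 ∈ Ω 0
      · exact Units.val_eq_one.mp (B8Eq119TwistedAxialRec.restr129Z_level_zero h129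
          (hlay m hm1 hmK b.1 (b.1 + e b.2) h (fun h' => hnb ⟨h, h'⟩) (he1 b)))
      · exact hu₁S _ h
    · by_cases h : b.1 + e b.2 ∈ Ω 0
      · exact Units.val_eq_one.mp (B8Eq119TwistedAxialRec.restr129Z_level_zero h129
          (hlay m hm1 hmK (b.1 + e b.2) b.1 h (fun h' => hnb ⟨h', h⟩) (he2 b)))
      · exact hu₁S _ h
  have hcol : ∀ b : Site d × Fin d, SideTouches (Ω 0) b.1 b.2 → ¬ (b.1 ∈ Ω 0 ∧ b.1 + e b.2 ∈ Ω 0) → η * ‖A' b.1 b.2‖ ≤ 2 * α₁ := by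
    intro b hsd hnb
    obtain ⟨hx, hxe⟩ := hu1 b hnb
    have hWb : U₁ b.1 b.2 = U' b.1 b.2 := by
      have h := congrFun (congrFun hW b.1) b.2
      rw [mgauge_apply, hx, hxe, one_mul] at h
      simpa using h
    -- `A′_b = (1/iη) log U₁_b` (smallness from (1.68) at level `0`)
    obtain ⟨hWe, hAb⟩ := hWA 0 (Nat.zero_le _) b.1 b.2 hsd
    have hsm : η * ‖A' b.1 b.2‖ ≤ 1 / 2 := by
      rw [pow_zero, one_mul] at hAb
      calc η * ‖A' b.1 b.2‖ ≤ η * (α₂ * η⁻¹) := mul_le_mul_of_nonneg_left hAb hη.le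
        _ = α₂ := by field_simp
        _ ≤ 1 / 2 := by linarith [h16', hα₂.le]
    have hlog : logCfg η U₁ b.1 b.2 = A' b.1 b.2 := logCfg_eq_of_cfgExp hη hWe hsm
    have hU'1 : ‖((U' b.1 b.2 : 𝔸ˣ) : 𝔸) - 1‖ ≤ 1 / 2 := (h66 b hsd).trans (by linarith [hα₁4])
    rw [← hlog, logCfg, hWb, norm_smul, norm_smul, norm_inv, norm_inv, Complex.norm_I, inv_one, one_mul, Real.norm_eq_abs,
      abs_of_pos hη, ← mul_assoc, mul_inv_cancel₀ hη.ne', one_mul]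
    exact (MatrixLog.norm_mlog_le_two_mul hU'1).trans (by linarith [h66 b hsd])
  -- THE EXTERIOR-COLLAR TERM `Φ₀(A′) ≤ 2α₁` (outer sides) and its window under `4B_∂ ≤ (dL − 1)B₀`
  set Φ₀ : ℝ := msup L m η (-(1 : ℝ)) (fun j (b : Site d × Fin d) => j = 0 ∧ SideTouches (Ω 0) b.1 b.2 ∧ ¬ BondTouches (Ω 0) b.1 b.2)
      (fun b => A' b.1 b.2) with hΦ₀_def
  have hΦ₀ : Φ₀ ≤ 2 * α₁ := by
    refine B8ScaledSupNorm.msup_le (by linarith) fun j hj b hb => ?_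
    obtain ⟨rfl, hsd, hnb⟩ := hb
    have e1 : (-(1 : ℝ)) = -((1 : ℕ) : ℝ) := by norm_num
    rw [e1, B8ScaledSupNorm.weight_neg_natCast L η 1 0, pow_one, pow_zero, one_mul]
    exact hcol b hsd fun h => hnb (Or.inl h.1)
  have hdr : (1 : ℝ) ≤ d := by exact_mod_cast (le_trans (by norm_num) hd2 : 1 ≤ d)
  have hdL1 : (0 : ℝ) ≤ (d : ℝ) * L - 1 := by nlinarith [hdr, hLr]
  have hbdry : 4 * Bbd * α₁ ≤ ((d : ℝ) * L - 1) * B₀ * (α₀ + α₁) := by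
    have h1 : 4 * Bbd * α₁ ≤ ((d : ℝ) * L - 1) * B₀ * α₁ := mul_le_mul_of_nonneg_right hBd hα₁.le
    have h2 : ((d : ℝ) * L - 1) * B₀ * α₁ ≤ ((d : ℝ) * L - 1) * B₀ * (α₀ + α₁) :=
      mul_le_mul_of_nonneg_left (by linarith) (mul_nonneg hdL1 hB₀)
    exact h1.trans h2
  have hβg : 2 * (Bbd * Φ₀) ≤ ((d : ℝ) * L - 1) * B₀ * (α₀ + α₁) := by
    have h1 := mul_le_mul_of_nonneg_left hΦ₀ hBbd
    linarith only [h1, hbdry]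
  -- PROPOSITION 3 at `m` levels for `A′` in edition γ: (1.55), «|B₁|γ < 2dLα₁ + C₂α₂²» (on PRINT's class — inner and crossing bonds at every
  -- level — by (1.42) + (1.37) read on the box in `Ω_{j−1}`, `norm_B1_lt_kLevel_γ`; on a level-0 crossing bond of `Ω₀` carried by the index's own
  -- `CrossB` disjunct `Q₀ = 1` and the term is `η‖A′(b)‖ ≤ 2α₁ ≤ 2dLα₁`, `hcol`), the bootstrap and the slack of (1.60) ⇒ (1.62) — the gradient member
  have h55 := B8Eq155KLevelLocal.eq155_norm_kLevel_hermitian hη hL1 hU₀1 hsa hα₀.le hα₂.le h16' hd5 hg0 h33m h40₁ h41' hg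
  have h41'' : ∀ j, j ≤ m → ∀ x μ, BondTouches (Ω j) x μ → ‖A' x μ‖ ≤ α₂ * ((L : ℝ) ^ j * η)⁻¹ :=
    fun j hj x μ hb => B8Prop3KLevel.bound_of_sideTouches hd2 (h41' j hj) x μ hb
  have hgZ := gZ_nonneg d L
  have hC0 : 0 ≤ (1 + 2 * gZ d L) * (2 * (131072 * ((d : ℝ) + 1) ^ 2) * (KZ d L) ^ 2) * Real.exp (4 * cZ d * ((L : ℝ) ^ 2 * α₀))
      * (L : ℝ) ^ 2 * α₂ ^ 2 := by
    positivity
  haveI : Nontrivial (Fin d) := Fin.nontrivial_iff_two_le.mpr hd2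
  obtain ⟨-, hg'', -, -⟩ := B8Prop3KLevelBdry.apriori_160_bdry (L := (L : ℝ)) (B₀ := B₀) (α₁ := α₁)
    (C₂ := (1 + 2 * gZ d L) * (2 * (131072 * ((d : ℝ) + 1) ^ 2) * (KZ d L) ^ 2) * Real.exp (4 * cZ d * ((L : ℝ) ^ 2 * α₀)) * (L : ℝ) ^ 2)
    (Nat.cast_nonneg d) hB₀ hα₂.le hg0 h55
    (by
      refine B8Eq155JBound.wsup_le (fun p => ?_) (by positivity)
      obtain ⟨⟨j, b⟩, hj, hc | ⟨hj0, hcr⟩⟩ := p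
      · have hj' : j ≤ m := hj
        have hc' : b ∈ Λb m j := hc
        show 1 * ‖linCovIterZ L U₀ (iEta η A') j b.1 b.2‖ ≤ _
        rw [one_mul]
        exact (B8Thm4KLevelGammaRec.norm_B1_lt_kLevel_γ hη hLs hs1 hd1 (avgClosedZ_unitaryUnits d L) U₀ hU₀ hα₀ hα3 hα4 A' hα₂.le hsmall hc₃
          hboxm h33m h41'' h42 hj' hc').le
      · have hj0' : j = 0 := hj0
        subst hj0'
        have hbt' : BondTouches (Ω 0) b.1 b.2 := hcr.1
        have hnb' : ¬ (b.1 ∈ Ω 0 ∧ b.1 + e b.2 ∈ Ω 0) := hcr.2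
        show 1 * ‖linCovIterZ L U₀ (iEta η A') 0 b.1 b.2‖ ≤ _
        rw [one_mul, B7SectEFLinearisationRec.linCovIterZ_zero, B8Eq154Local.norm_iEta_apply hη.le]
        obtain ⟨κ, hκ⟩ := exists_ne b.2
        have hsd : SideTouches (Ω 0) b.1 b.2 := B8Eq140Level.sideTouches_of_bondTouches hκ hbt'
        have h1 : 2 * α₁ ≤ 2 * d * L * α₁ := by
          have h := mul_le_mul_of_nonneg_right hdL (by positivity : (0 : ℝ) ≤ 2 * α₁)
          linarith only [h]
        linarith only [hcol b hsd hnb', h1, hC0])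
    h59a h59g h59a h59a hside h50
  set R₀ := B₀ * (4 * α₀ + 4 * d * L * α₁ + 2 * α₂ ^ 2 + 20 * d * α₀ * α₂
      + 2 * ((1 + 2 * gZ d L) * (2 * (131072 * ((d : ℝ) + 1) ^ 2) * (KZ d L) ^ 2) * Real.exp (4 * cZ d * ((L : ℝ) ^ 2 * α₀)) * (L : ℝ) ^ 2)
        * α₂ ^ 2) with hR₀
  set R₁ := B₀ * (4 * α₀ + 4 * d * L * α₁ + 2 * α₂ ^ 2 + 20 * d * α₀ * α₂ + 2 * C₂ * α₂ ^ 2) with hR₁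
  have hR : R₀ ≤ R₁ := by
    rw [hR₀, hR₁]
    apply mul_le_mul_of_nonneg_left _ hB₀
    have hsq : 0 ≤ α₂ ^ 2 := sq_nonneg _
    have hCC := mul_le_mul_of_nonneg_right hC₂ hsq
    linarith only [hCC]
  have h162g : R₁ + 2 * (Bbd * Φ₀) ≤ 5 * d * L * B₀ * (α₀ + α₁) := by
    rw [hR₁]; exact B8Prop3KLevelBdry.apriori_162_bdry hB₀ hdL hα₀.le h61 hβg
  have hg' : g ≤ 5 * d * L * B₀ * (α₀ + α₁) := by linarith only [hg'', hR, h162g]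
  intro j hj y κ τ hs
  exact (hg j hj y κ τ hs).trans hg'

end Grad

/-! ## §2 THE LEVEL-`m` ASSEMBLY: the ∃λ-body of `SockHFP` from the JOIN, the datum dictionary and the β (1.59) clause -/
section Body

variable {𝔸 : Type*} [CStarAlgebra 𝔸] [Nontrivial 𝔸]
/-- ★ **PROPOSITION 5'S FIXED POINT FOR THE LEVEL-`m` DATUM OF THEOREM 4, [4]'s INVERSE LAWS ON PRINT'S DOMAINS, WITH THEOREM 4'S OWN (1.59)-CLAUSE
IN PLACE OF THE b9 SOCKET, EDITION γ** — g8's `B8SockHFP59BdryBeta.sockHFP_body_of_join_59_bdryβ` (p552062) VERBATIM except: the datum class law `hbox` and the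
(1.35) hypothesis `h135` re-guarded at `Ω (j − 1)` (print's class: inner and crossing bonds), the (1.61) remainder constant of edition γ in `hC₂`, and [3] Prop. 4's
windows ONE LEVEL LOWER (`hα3γ`, `hα4γ`, `h16γ`, `hsmallγ`, `hc₃γ` at `(L²α₀, L·c⋆)`) displayed next to the JOIN's own windows; the in-edge `H59Dβm` (the
two-member clause, β-shaped index over `Λb m j ∪ {level-0 crossing bonds}`, exterior-collar allowance) and the boundary-layer law `hlay` as there; the source
bound comes from §1's `grad_bound_of_datum59_γ`.
[cite: Balaban1985RegularSpaces, Prop. 5 (1.106)–(1.109) p.94, Thm 4 p.88, (1.66)–(1.69) p.88, p.89, (1.31) p.82, (1.92)–(1.103) pp.92–93; Balaban1985BackgroundPropagators, Thm 3.1 p.397, (3.25) p.394, Thm 3.3 p.398, (3.16) p.393; Balaban1984PropagatorsII, (2.3) p.224] -/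
theorem sockHFP_body_of_join_59_γ (hd2 : 2 ≤ d) {L sL : ℕ} (hLs : L = 2 * sL + 1) (hs1 : 1 ≤ sL) {η : ℝ} (hη : 0 < η) {k : ℕ}
    -- the member's geometry
    {Ω : ℕ → Set (Site d)} (hΩ : ∀ j, Ω (j + 1) ⊆ Ω j) {Λs : ℕ → ℕ → Set (Site d)} {Λb : ℕ → ℕ → Set (Site d × Fin d)}
    -- PRINT's box law (edition γ): the locality box of a level-`j` datum bond lies in `Ω_{j−1}` ((1.31); level 0: `Ω₀`)
    (hbox : ∀ m, m ≤ k → ∀ j, j ≤ m → ∀ c ∈ Λb m j, ∀ x, InBox (fun i => (L : ℤ) ^ j * c.1 i - (ctrShift L j : ℤ)) (fun i => (L : ℤ) ^ j * c.1 i + (ctrShift L j : ℤ) + if i = c.2 then (L : ℤ) ^ j else 0) x → x ∈ Ω (j - 1))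
    (hclass : ∀ m, m ≤ k → ∀ j, j ≤ m → ∀ c ∈ Λb m j,
      (c.1 ∈ Λs m j ∧ c.1 + e c.2 ∈ Λs m j) ∨
      (∃ j', j = j' + 1 ∧ (∀ x, (L : ℤ) • c.1 - halfVec L ≤ x → x ≤ (L : ℤ) • c.1 + halfVec L → x ∈ Λs m j') ∧ c.1 + e c.2 ∈ Λs m j) ∨
      (∃ j', j = j' + 1 ∧ c.1 ∈ Λs m j ∧ (∀ x, (L : ℤ) • (c.1 + e c.2) - halfVec L ≤ x → x ≤ (L : ℤ) • (c.1 + e c.2) + halfVec L → x ∈ Λs m j')))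
    {m : ℕ} (hm1 : 1 ≤ m) (hmk : m < k)
    (htower : ∀ j, j ≤ m + 1 → ∀ y ∈ Λs (m + 1) j, ∀ x, InBox (tlo L y j) (thi L y j) x → x ∈ Ω j)
    (hlt : ∀ j, j < m → Λs m j = Λs (m + 1) j)
    (htop : ∀ x, x ∈ Λs m m ↔ x ∈ Λs (m + 1) m ∨ ∃ y ∈ Λs (m + 1) (m + 1), x ∈ blockSitesZ L y)
    -- the socket's antecedents: constants, (1.33), (1.34), (1.35)/(1.66)
    {α₀ α₁ B₀ B₀' cs α₄ : ℝ} (hα₀ : 0 < α₀) (hα₁ : 0 < α₁) (hB₀ : 0 < B₀) (hB₀' : 0 < B₀')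
    (hcs : cs = 5 * (d : ℝ) * L * B₀ * (α₀ + α₁)) (hα₄ : α₄ = 8 * B₀' * (5 * (d : ℝ) * L * B₀) * (α₀ + α₁))
    {U₀ U' : Site d → Fin d → 𝔸ˣ} (hU₀ : ∀ x κ, U₀ x κ ∈ unitaryUnits 𝔸) (hU' : ∀ x κ, U' x κ ∈ unitaryUnits 𝔸)
    (h33 : InAk L k η α₀ Ω U₀) (h34 : InAk L k η α₀ Ω (mulCfg U' U₀)) (hAx : ∀ m', m' ≤ k → InAxZ L m' (Λs m') U₀ (mulCfg U' U₀))
    -- (1.35) for the datum in PRINT's class: every level-`j` bond whose locality box lies in `Ω_{j−1}`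
    (h135 : ∀ j, j ≤ k → ∀ (z : Site d) (μ : Fin d), (∀ x, InBox (fun i => (L : ℤ) ^ j * z i - (ctrShift L j : ℤ)) (fun i => (L : ℤ) ^ j * z i + (ctrShift L j : ℤ) + if i = μ then (L : ℤ) ^ j else 0) x → x ∈ Ω (j - 1)) →
      ‖(avgIterZ L (mulCfg U' U₀) j z μ : 𝔸) - (avgIterZ L U₀ j z μ : 𝔸)‖ ≤ α₁)
    (h66 : ∀ b ∈ {b : Site d × Fin d | SideTouches (Ω 0) b.1 b.2}, ‖((U' b.1 b.2 : 𝔸ˣ) : 𝔸) - 1‖ ≤ α₁)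
    -- the boundary-layer law of the member's region
    (hlay : ∀ m, 1 ≤ m → m ≤ k → ∀ y z : Site d, y ∈ Ω 0 → z ∉ Ω 0 → (∀ i, y i - 1 ≤ z i ∧ z i ≤ y i + 1) → y ∈ Λs m 0)
    -- the exterior-collar constant and its absorption window
    {Bbd : ℝ} (hBbd : 0 ≤ Bbd) (hBd : 4 * Bbd ≤ ((d : ℝ) * L - 1) * B₀)
    -- the datum at level `m`
    {u₁ : Site d → 𝔸ˣ} {U₁ : Site d → Fin d → 𝔸ˣ} {A : Site d → Fin d → 𝔸}
    (hu₁ : ∀ x, u₁ x ∈ unitaryUnits 𝔸) (hu₁S : ∀ x, x ∉ Ω 0 → u₁ x = 1) (hW : mgauge U₀ u₁ U₁ = U')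
    (h129 : Restr129Z L m (Λs m) U₀ u₁)
    (hLan : IsLandau138WZ L m η (Ω 0) (Λs m) U₀ U₁)
    (hdat : ∀ j, j ≤ m → ∀ b ∈ {b : Site d × Fin d | SideTouches (Ω j) b.1 b.2},
      U₁ b.1 b.2 = cfgExp η A b.1 b.2 ∧ IsSelfAdjoint (A b.1 b.2) ∧ ‖A b.1 b.2‖ ≤ cs * ((L : ℝ) ^ j * η)⁻¹)
    -- Theorem 4's own TWO-member (1.59) clause for the level-`m` datum at background `U₀`, WITH THE EXTERIOR-COLLAR ALLOWANCE
    (H59Dβm : ∀ A' : Site d → Fin d → 𝔸, (∀ y τ, IsSelfAdjoint (A' y τ)) →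
      (∀ j, j ≤ m → ∀ (y : Site d) (τ : Fin d), SideTouches (Ω j) y τ →
        U₁ y τ = cfgExp η A' y τ ∧ ‖A' y τ‖ ≤ cs * ((L : ℝ) ^ j * η)⁻¹) →
      (∀ (y : Site d) (τ : Fin d), (∀ j, j ≤ m → ¬ SideTouches (Ω j) y τ) → A' y τ = 0) →
      msup L m η (-(1 : ℝ)) (fun j (b : Site d × Fin d) => SideTouches (Ω j) b.1 b.2) (fun b => A' b.1 b.2)
          ≤ B₀ * (bondNorm L m η (-(3 : ℝ)) Ω (fun x μ => Jcur η U₀ A' μ x)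
            + wsup 1 (fun p : {p : ℕ × (Site d × Fin d) // p.1 ≤ m ∧ (p.2 ∈ Λb m p.1 ∨ (p.1 = 0 ∧ CrossB (Ω 0) p.2))} =>
                linCovIterZ L U₀ (iEta η A') p.1.1 p.1.2.1 p.1.2.2))
            + Bbd * msup L m η (-(1 : ℝ)) (fun j (b : Site d × Fin d) => j = 0 ∧ SideTouches (Ω 0) b.1 b.2 ∧ ¬ BondTouches (Ω 0) b.1 b.2)
                (fun b => A' b.1 b.2) ∧
        msup L m η (-(2 : ℝ)) (fun j (t : Fin d × Fin d × Site d) => SideTouches (Ω j) t.2.2 t.2.1)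
            (fun t => covDerivFwd η U₀ t.1 (fun z => A' z t.2.1) t.2.2)
          ≤ B₀ * (bondNorm L m η (-(3 : ℝ)) Ω (fun x μ => Jcur η U₀ A' μ x)
            + wsup 1 (fun p : {p : ℕ × (Site d × Fin d) // p.1 ≤ m ∧ (p.2 ∈ Λb m p.1 ∨ (p.1 = 0 ∧ CrossB (Ω 0) p.2))} =>
                linCovIterZ L U₀ (iEta η A') p.1.1 p.1.2.1 p.1.2.2))
            + Bbd * msup L m η (-(1 : ℝ)) (fun j (b : Site d × Fin d) => j = 0 ∧ SideTouches (Ω 0) b.1 b.2 ∧ ¬ BondTouches (Ω 0) b.1 b.2)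
                (fun b => A' b.1 b.2))
    -- Proposition 3's windows at `(α₀, α₂ := c⋆)` not implied by the JOIN's, the (1.61) window with the γ remainder constant
    {C₂ : ℝ} (hside : 36 * d * B₀ * cs ≤ 1 / 2)
    (hC₂ : (1 + 2 * gZ d L) * (2 * (131072 * ((d : ℝ) + 1) ^ 2) * (KZ d L) ^ 2) * Real.exp (4 * cZ d * ((L : ℝ) ^ 2 * α₀)) * (L : ℝ) ^ 2 ≤ C₂)
    (h61 : 2 * cs ^ 2 + 20 * d * α₀ * cs + 2 * C₂ * cs ^ 2 ≤ α₀ + α₁) (hsmall₁ : (d : ℝ) * L * α₁ ≤ 1 / 8)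
    -- EDITION γ: [3] Prop. 4's windows ONE LEVEL LOWER, at `(L²α₀, L·c⋆)`, for the (1.42)∕(1.56) steps at the datum bonds (box ⊂ Ω_{j−1})
    (hα3γ : C0Z d * ((L : ℝ) ^ 2 * α₀) ≤ 1 / 3) (hα4γ : 4 * ((L : ℝ) ^ 2 * α₀) ≤ c2' d L) (h16γ : 16 * ((L : ℝ) * cs) ≤ 1)
    (hsmallγ : Real.exp (4 * cZ d * ((L : ℝ) ^ 2 * α₀)) * (1 + 2 * (131072 * ((d : ℝ) + 1) ^ 2) * (KZ d L) ^ 2 * ((L : ℝ) * cs)) ≤ 2)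
    (hc₃γ : KZ d L * ((L : ℝ) * cs) ≤ c3 d L)
    -- the [4] LETTERS at `(m + 1, U₀)`, displayed as the JOIN reads them
    (g Δ : (Site d → 𝔸) →ₗ[ℂ] (Site d → 𝔸)) (q : (Site d → 𝔸) →ₗ[ℂ] (ℕ → Site d → 𝔸)) (qs : (ℕ → Site d → 𝔸) →ₗ[ℂ] (Site d → 𝔸))
    (Aw c : (ℕ → Site d → 𝔸) →ₗ[ℂ] (ℕ → Site d → 𝔸))
    (g_rightΩ : ∀ x, ∀ y ∈ Ω 0, (Δ (g x) + qs (Aw (q (g x)))) y = x y)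
    (c_range : ∀ f, q (g (g (qs (c (q f))))) = q f)
    (hΔ : ∀ (f : Site d → 𝔸), ∀ x ∈ Ω 0, Δ f x = covLap η U₀ ((Ω 0).indicator f) x)
    (hqs : ∀ (μ : ℕ → Site d → 𝔸), ∀ x ∈ Ω 0, qs μ x = QTZ L (m + 1) (Λs (m + 1)) U₀ μ x)
    (hq : ∀ (f : Site d → 𝔸) (j : ℕ), j ≤ m + 1 → ∀ y ∈ Λs (m + 1) j, q f j y = QprimeIter (zdBlockingZ d L) (bgTZ L U₀) j f y)
    (H' : XSpace d (m + 1) 𝔸 →ₗ[ℂ] (Site d → 𝔸)) {B₀'H B₂' BG BR : ℝ} (hB₀'H : 0 < B₀'H) (hB₂' : 0 ≤ B₂') (hBG : 0 ≤ BG) (hBR : 0 ≤ BR)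
    (hH0 : ∀ (X : XSpace d (m + 1) 𝔸) (x : Site d), ‖H' X x‖ ≤ B₀'H * ‖X‖)
    (hH1 : ∀ j, j ≤ m + 1 → ∀ (X : XSpace d (m + 1) 𝔸), ∀ p ∈ {b : Site d × Fin d | SideTouches (Ω j) b.1 b.2},
      wt L η j * ‖covDerivFwd η U₀ p.2 (H' X) p.1‖ ≤ B₀'H * ‖X‖)
    (hH2 : ∀ X : XSpace d (m + 1) 𝔸, Bd2 L η (m + 1) Ω (covLap η U₀ (H' X)) (B₂' * ‖X‖))
    (hHsupp : ∀ (X : XSpace d (m + 1) 𝔸) (x : Site d), x ∉ Ω 0 → H' X x = 0)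
    (hHequiv : ∀ X Y : XSpace d (m + 1) 𝔸, (∀ p, Y p = -star (X p)) → ∀ x, H' Y x = -star (H' X x))
    (hQH : ∀ (Y : XSpace d (m + 1) 𝔸) (j : ℕ) (hj : j ≤ m + 1) (y : Site d), y ∈ Λs (m + 1) j →
      QprimeIter (zdBlockingZ d L) (bgTZ L U₀) j (H' Y) y = Y (⟨j, Nat.lt_succ_of_le hj⟩, y))
    (hG : ∀ (f : Site d → 𝔸) (r : ℝ), 0 ≤ r → Bd2 L η (m + 1) Ω f r →
      (∀ x, ‖g f x‖ ≤ BG * r) ∧ ∀ j, j ≤ m + 1 → ∀ p ∈ {b : Site d × Fin d | SideTouches (Ω j) b.1 b.2},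
        wt L η j * ‖covDerivFwd η U₀ p.2 (g f) p.1‖ ≤ BG * r)
    (hGsupp : ∀ (f : Site d → 𝔸) (x : Site d), x ∉ Ω 0 → g f x = 0)
    (hGreal : ∀ f : Site d → 𝔸, (∀ j, j ≤ m + 1 → ∀ x ∈ Ω j, IsSelfAdjoint (f x)) → ∀ x, IsSelfAdjoint (g f x))
    (hRbd : ∀ (f : Site d → 𝔸) (r : ℝ), 0 ≤ r → Bd2 L η (m + 1) Ω f r → Bd2 L η (m + 1) Ω (f - g (qs (c (q (g f))))) (BR * r))
    (hRreal : ∀ f : Site d → 𝔸, (∀ j, j ≤ m + 1 → ∀ x ∈ Ω j, IsSelfAdjoint (f x)) →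
      ∀ j, j ≤ m + 1 → ∀ x ∈ Ω j, IsSelfAdjoint ((f - g (qs (c (q (g f))))) x))
    -- the JOIN's scalar windows, one-for-one (`αP := α₀`, `α₄ := 8B₀′c⋆`; `cB cA cDA` free above their datum values)
    {cB cA cDA : ℝ} (hcBlo : L * cs ≤ cB) (hcAlo : L * cs ≤ cA) (hcDAlo : (d : ℝ) * (L : ℝ) ^ 2 * cs ≤ cDA)
    (hα3 : C0Z d * α₀ ≤ 1 / 3) (hα4 : 4 * α₀ ≤ c2' d L)
    (hsmall : Real.exp (4 * cZ d * α₀) * (1 + 2 * (131072 * ((d : ℝ) + 1) ^ 2) * (KZ d L) ^ 2 * cB) ≤ 2)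
    (hc₃ : KZ d L * cB ≤ c3 d L) (hsc : 1024 * (d : ℝ) * KZ d L * cB ≤ 1) (hα₃' : 20 * d * KZ d L * cB ≤ 1 / 200)
    (hs₁ : 200 * C6 d * (2 * α₄) ≤ 1) (hs₂ : 12000 * ((d : ℝ) + 1) * L * (2 * α₄) ≤ 1)
    (hs₃ : C4G d L * (α₀ + 20 * d * KZ d L * cB + 4 * (2 * α₄)) ≤ 1)
    (hs₄ : 1024 * ((d : ℝ) + 1) * ((d : ℝ) + 4) * L ^ 2 * α₀ ≤ 1) (hs₅ : 32 * ((d : ℝ) + 1) ^ 2 * C6 d * L ^ 2 * α₀ ≤ 1)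
    (hs₆ : 16 * d * C5' d * C6 d * (L : ℝ) ^ 2 * α₀ ≤ 1) (hs₇ : 8 * d * C6 d * L * α₀ ≤ 1)
    (hsm : 20 * d * KZ d L * cB + α₄ ≤ 1 / (4 * B₀'H * (2 * C2p d))) (hprod8 : 2 * C6 d * (20 * d * KZ d L * cB + 4 * α₄) ≤ 1 / 8)
    {hE hE₂ lE lE₂ : ℝ} (hE_def : hE = B₀'H * (C2p d * (20 * d * KZ d L * cB + α₄) * α₄)) (hE₂_def : hE₂ = B₂' * (C2p d * (20 * d * KZ d L * cB + α₄) * α₄))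
    (lE_def : lE = B₀'H * (4 * C2p d * (20 * d * KZ d L * cB + 2 * α₄))) (lE₂_def : lE₂ = B₂' * (4 * C2p d * (20 * d * KZ d L * cB + 2 * α₄)))
    (hcA' : cA ≤ 1 / 13) (ha₁' : α₄ / 4 + hE ≤ 1 / 24) (hb₁' : α₄ / 4 + hE ≤ 1 / 140) (hθ : 10 * (α₄ / 4 + hE) * BR ≤ 1 / 2)
    (h103 : BG * Mc d BR (α₄ / 4 + hE) cA hE₂ cDA ≤ α₄ / 4)
    (h106 : BG * Kc d BR (α₄ / 4 + hE) cA hE₂ cDA lE₂ (1 + lE) (1 + lE) ≤ 1 / 2) :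
    ∃ lam : Site d → 𝔸, (∀ x, IsSelfAdjoint (lam x)) ∧ (∀ x, x ∉ Ω 0 → lam x = 0) ∧
      (∀ j, j ≤ m + 1 → ∀ b ∈ {b : Site d × Fin d | SideTouches (Ω j) b.1 b.2},
        ‖lam b.1‖ ≤ α₄ ∧ ((L : ℝ) ^ j * η) * ‖covDerivFwd η U₀ b.2 lam b.1‖ ≤ α₄) ∧
      (∃ μ : ℕ → Site d → 𝔸, ∀ x ∈ Ω 0,
        covLap η U₀ ((Ω 0).indicator fun y => covDivB η U₀ A y + covLap η U₀ lam y +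
          ((conjR (gaugeExp lam y)⁻¹ (covDivB η U₀ A y) - covDivB η U₀ A y) +
            (gAd (covLap η U₀ lam y) (lam y) - covLap η U₀ lam y) + ∑ μ, frakF3 η U₀ lam A y μ)) x =
          QTZ L (m + 1) (Λs (m + 1)) U₀ μ x) ∧
      Restr129Z L (m + 1) (Λs (m + 1)) U₀ (u₁ * gaugeExp lam) := by
  subst hcs
  have hL1 : 1 ≤ L := by omega
  have hd1 : 1 ≤ d := le_trans (by norm_num) hd2
  have hLr : (1 : ℝ) ≤ L := by exact_mod_cast hL1
  have hmK : m + 1 ≤ k := hmk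
  have hsum : 0 < α₀ + α₁ := add_pos hα₀ hα₁
  have hcs0 : 0 ≤ 5 * (d : ℝ) * L * B₀ * (α₀ + α₁) := by positivity
  have hcspos : 0 < 5 * (d : ℝ) * L * B₀ * (α₀ + α₁) := by positivity
  have hα₄pos : 0 < α₄ := by rw [hα₄]; positivity
  -- `c⋆ ≤ L·c⋆ ≤ cB`, hence Prop. 3's remaining windows from the JOIN's
  have hcsB : 5 * (d : ℝ) * L * B₀ * (α₀ + α₁) ≤ cB := (le_mul_of_one_le_left hcs0 hLr).trans hcBlo
  have hcB0 : 0 ≤ cB := hcs0.trans hcsB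
  have hcA0 : 0 ≤ cA := (hcs0.trans (le_mul_of_one_le_left hcs0 hLr)).trans hcAlo
  have hcDA0 : 0 ≤ cDA := le_trans (by positivity) hcDAlo
  have hd0 : (1 : ℝ) ≤ d := by exact_mod_cast hd1
  have hK2 : (2 : ℝ) ≤ KZ d L := by have h := gZ_nonneg d L; show (2 : ℝ) ≤ 2 * (1 + 2 * gZ d L); linarith only [h]
  have hcBsmall : (d : ℝ) * cB ≤ 1 / 8000 := by
    have h0 : 0 ≤ (d : ℝ) * cB := by positivity
    have h1 : (d : ℝ) * cB * 2 ≤ (d : ℝ) * cB * KZ d L := mul_le_mul_of_nonneg_left hK2 h0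
    linarith only [hα₃', h1]
  have hdcs : (d : ℝ) * (5 * (d : ℝ) * L * B₀ * (α₀ + α₁)) ≤ 1 / 8000 :=
    (mul_le_mul_of_nonneg_left hcsB (by positivity)).trans hcBsmall
  have hcs8000 : 5 * (d : ℝ) * L * B₀ * (α₀ + α₁) ≤ 1 / 8000 := (le_mul_of_one_le_left hcs0 hd0).trans hdcs
  have h50 : 50 * d * (5 * (d : ℝ) * L * B₀ * (α₀ + α₁)) ≤ 1 := by linarith only [hdcs]
  have hd5 : 5 * (5 * (d : ℝ) * L * B₀ * (α₀ + α₁)) * ((d : ℝ) - 1) ≤ 4 := by nlinarith only [hdcs, hcs0]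
  have hαP2 : 2 * α₀ ≤ c2' d L := by linarith only [hα4, hα₀]
  -- the MASKED exponent `A′` of the datum (globally Hermitian, `= A` on the touched bonds)
  obtain ⟨A', hsa, hagree, hWA, hA0⟩ := exists_masked_datum hdat
  have hWA1 : ∀ j, j ≤ m → ∀ (y : Site d) (τ : Fin d), SideTouches (Ω j) y τ → U₁ y τ = cfgExp η A' y τ :=
    fun j hj y τ hs => (hWA j hj y τ hs).1
  have h41 : ∀ j, j ≤ m → ∀ (y : Site d) (τ : Fin d), SideTouches (Ω j) y τ →
      ‖A' y τ‖ ≤ (5 * (d : ℝ) * L * B₀ * (α₀ + α₁)) * ((L : ℝ) ^ j * η)⁻¹ := fun j hj y τ hs => (hWA j hj y τ hs).2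
  -- the JOIN's datum binders BY NAME (`B8Prop5SocketDatum` §7, §1, §5)
  have h33' := h33_of_inAk hL1 hα₀ h33 hmK htower
  have hP' := hP_of_datum hL1 hα₀ hΩ h34 hmK htower hu₁ hW hWA1
  have h69' : ∀ j, j ≤ m + 1 → ∀ y ∈ Λs (m + 1) j, ∀ (x : Site d) (κ : Fin d), InBox (tlo L y j) (thi L y j) x →
      InBox (tlo L y j) (thi L y j) (x + e κ) → ‖iEta η A' x κ‖ ≤ cB * ((L : ℝ) ^ j)⁻¹ :=
    fun j hj y hy x κ hx hxe =>
      (h69_of_datum hd2 hL1 hη hΩ htower hcs0 h41 j hj y hy x κ hx hxe).trans (mul_le_mul_of_nonneg_right hcBlo (by positivity))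
  have hA' : ∀ j, j ≤ m + 1 → ∀ x ∈ Ω j, ∀ μ : Fin d,
      wt L η j * ‖A' x μ‖ ≤ cA ∧ wt L η j * ‖conjR (U₀ (x - e μ) μ)⁻¹ (A' (x - e μ) μ)‖ ≤ cA := fun j hj x hx μ =>
    ⟨(hA_of_datum hd2 hL1 hη hΩ hU₀ hcs0 h41 j hj x hx μ).1.trans hcAlo, (hA_of_datum hd2 hL1 hη hΩ hU₀ hcs0 h41 j hj x hx μ).2.trans hcAlo⟩
  have hBu : ∀ (x : Site d) (κ : Fin d), expCfg (iEta η A') x κ ∈ unitaryUnits 𝔸 := expCfg_iEta_mem_unitaryUnits η hsa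
  have hAx' : InAxZ L (m + 1) (Λs (m + 1)) U₀ (mgauge U₀ u₁ (expCfg (iEta η A')) * U₀) :=
    inAx_mgauge_expCfg_of_datum hd2 hLs hΩ htower hW hWA1 (hAx (m + 1) hmK)
  have h129' : Restr129Z L (m + 1) (Λs (m + 1)) U₀ u₁ := restr129Z_succ_of_truncation hL1 hlt htop h129
  -- the source `D*A′`: (1.69)'s gradient member by Prop. 3 at level `m` (§3), then `|D*A′|₍₋₂₎ ≤ d·L²·c⋆ ≤ cDA` (§4); Hermitian
  obtain ⟨h59a, h59g⟩ := H59Dβm A' hsa hWA hA0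
  have hgrad := grad_bound_of_datum59_γ hd2 hη hLs hs1 k hU₀ hU' hα₀ hα₁ hcspos hB₀.le hα3γ hα4γ h16γ hd5 hsmallγ hc₃γ hside h50 hC₂ h61
    hsmall₁ Ω hΩ Λs Λb hbox hclass h33 h34 hAx h135 h66 hlay hBbd hBd hm1 hmk.le hu₁ hu₁S hW h129 hLan hsa hWA hA0 h59a h59g
  have hDA : Bd2 L η (m + 1) Ω (fun y => covDivB η U₀ A' y) cDA := fun j hj x hx =>
    (bd2_covDivB_of_grad hd2 hL1 hη hΩ hU₀ hcs0 hgrad j hj x hx).trans hcDAlo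
  have hDAsa : ∀ j, j ≤ m + 1 → ∀ x ∈ Ω j, IsSelfAdjoint (covDivB η U₀ A' x) := fun j _ x _ => isSelfAdjoint_covDivB hU₀ hsa x
  -- the JOIN's bond classes `Eb j := {b ∣ SideTouches (Ω j) b}` (§6)
  have hEbΩ : ∀ j, j ≤ m + 1 → ∀ x ∈ Ω j, ∀ μ : Fin d, (x, μ) ∈ {b : Site d × Fin d | SideTouches (Ω j) b.1 b.2} ∧
      (x - e μ, μ) ∈ {b : Site d × Fin d | SideTouches (Ω j) b.1 b.2} := fun j _ x hx μ => sideTouches_pair_of_mem hd2 hx μ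
  have hEbT : ∀ j, j ≤ m + 1 → ∀ y ∈ Λs (m + 1) j, ∀ (x : Site d) (κ : Fin d), InBox (tlo L y j) (thi L y j) x →
      InBox (tlo L y j) (thi L y j) (x + e κ) → (x, κ) ∈ {b : Site d × Fin d | SideTouches (Ω j) b.1 b.2} :=
    fun j hj y hy x κ hx _ => sideTouches_of_tower_bond hd2 htower hj hy x κ hx
  -- THE JOIN WITH THE LAWS ON PRINT'S DOMAINS (`hFP_kLevel_of_sectE_local'_RD`, BY NAME) at `k := m + 1`, `Λs := Λs (m+1)`, `B := iηA′`, `αP := α₀`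
  obtain ⟨lam, hlsa, hloff, h108, ⟨μ, hmul⟩, h129''⟩ := hFP_kLevel_of_sectE_local'_RD (k := m + 1) (Λs := Λs (m + 1))
    (Eb := fun j => {b : Site d × Fin d | SideTouches (Ω j) b.1 b.2}) (u₁ := u₁) (A := A') hLs hs1 hη hU₀ hEbΩ hEbT g Δ q qs Aw c
    g_rightΩ c_range hΔ hqs hq H' hα₀ hα3 hα4 hcB0 hα₄pos hB₀'H hB₂' h33' h69' hd1 hα₀ hα3 hαP2 hBu hP' hAx' h129' hH0 hH1 hH2 hHsupp
    hHequiv hQH hsmall hc₃ hsc hα₃' hs₁ hs₂ hs₃ hs₄ hs₅ hs₆ hs₇ hsm hprod8 hE_def hE₂_def lE_def lE₂_def hBG hBR hcA0 hcA' hcDA0 ha₁' hb₁'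
    hθ hG hGsupp hGreal hRbd hRreal hDA hDAsa hA' hsa h103 h106
  refine ⟨lam, hlsa, hloff, fun j hj b hb => h108 j hj b hb, ⟨μ, fun x hx => ?_⟩, h129''⟩
  -- transport the multiplier clause from `A′` back to `A`: the two agree on the bonds read on `Ω₀`
  have hind : ((Ω 0).indicator fun y => covDivB η U₀ A y + covLap η U₀ lam y +
        ((conjR (gaugeExp lam y)⁻¹ (covDivB η U₀ A y) - covDivB η U₀ A y) +
          (gAd (covLap η U₀ lam y) (lam y) - covLap η U₀ lam y) + ∑ μ, frakF3 η U₀ lam A y μ)) =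
      ((Ω 0).indicator fun y => covDivB η U₀ A' y + covLap η U₀ lam y +
        ((conjR (gaugeExp lam y)⁻¹ (covDivB η U₀ A' y) - covDivB η U₀ A' y) +
          (gAd (covLap η U₀ lam y) (lam y) - covLap η U₀ lam y) + ∑ μ, frakF3 η U₀ lam A' y μ)) := by
    refine Set.indicator_congr fun y hy => ?_
    have h₁ : ∀ ν : Fin d, A' y ν = A y ν := fun ν => hagree 0 (Nat.zero_le _) y ν (sideTouches_pair_of_mem hd2 hy ν).1
    have h₂ : ∀ ν : Fin d, A' (y - e ν) ν = A (y - e ν) ν := fun ν => hagree 0 (Nat.zero_le _) (y - e ν) ν (sideTouches_pair_of_mem hd2 hy ν).2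
    have h₃ : ∀ ν : Fin d, frakF3 η U₀ lam A' y ν = frakF3 η U₀ lam A y ν := fun ν => frakF3_congr_at η U₀ lam (h₁ ν) (h₂ ν)
    simp only [covDivB_congr_at η U₀ h₁ h₂, h₃]
  rw [hind]
  exact hmul x hx
end Body

/-! ## §3 THE SAME AT THE BASE DATUM `u₁ = 1`, `U₁ = U′` (p. 89): the ∃λ-body of `SockHFP₀` from the JOIN at one level -/

section Base

variable {𝔸 : Type*} [CStarAlgebra 𝔸] [Nontrivial 𝔸]

/-- **PROPOSITION 5'S FIXED POINT FOR THE BASE DATUM OF THEOREM 4, [4]'s INVERSE LAWS ON PRINT'S DOMAINS — the ∃λ-body of `B8LeafModelZdOfHFP.SockHFP₀` assembled from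
the JOIN `hFP_kLevel_of_sectE_local'_RD` at ONE level.**  `B8SockHFPAssembly.sockHFP₀_body_of_join` VERBATIM except the letters binders (no `g_left`; `g_rightΩ`, `c_range`;
dag-ref-A W8/W8′).  The base datum (p. 89: «for k = 0 … u₁ = 1, U₁ = U′»): `U′ = e^{iηA}`, `A` Hermitian, `|A| ≤ c⋆η⁻¹` on the sides of the plaquettes
touching `Ω₀`; the JOIN runs at `k := 1` for `Λs 1` with `u₁ := 1` ((1.29) for `1` by `B8Thm4TruncationLocal.restr129_one`, `U^{1} = U`), the
source bound from the WEIGHT-FREE gradient bound `η²|∇A′| ≤ 2c⋆` (`B8Prop5SocketDatum.grad_bound_trivial` — no Proposition 3, no b9 socket at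
level `0`), whence `cDA ≥ 2·d·L²·c⋆`; everything else as `sockHFP_body_of_join_RD` with `m + 1 = 1` (towers of `Λs 1` inside `Ω_j`, the [4]
LETTERS at `(1, U₀)`, the JOIN's windows one-for-one).  CONCLUSION — VERBATIM the ∃λ-body of `SockHFP₀`.
[cite: Balaban1985RegularSpaces, Prop. 5 (1.106)–(1.109) p.94, p.89 (the start of the induction), (1.66) p.88, (1.92)–(1.103) pp.92–93] -/
theorem sockHFP₀_body_of_join_RD (hd2 : 2 ≤ d) {L sL : ℕ} (hLs : L = 2 * sL + 1) (hs1 : 1 ≤ sL) {η : ℝ} (hη : 0 < η) {k : ℕ} (hk : 1 ≤ k)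
    -- the member's geometry
    {Ω : ℕ → Set (Site d)} (hΩ : ∀ j, Ω (j + 1) ⊆ Ω j) {Λs : ℕ → ℕ → Set (Site d)}
    (htower : ∀ j, j ≤ 1 → ∀ y ∈ Λs 1 j, ∀ x, InBox (tlo L y j) (thi L y j) x → x ∈ Ω j)
    -- the socket's antecedents: constants, (1.33), (1.34)
    {α₀ α₁ B₀ B₀' cs α₄ : ℝ} (hα₀ : 0 < α₀) (hα₁ : 0 < α₁) (hB₀ : 0 < B₀) (hB₀' : 0 < B₀')
    (hcs : cs = 5 * (d : ℝ) * L * B₀ * (α₀ + α₁)) (hα₄ : α₄ = 8 * B₀' * (5 * (d : ℝ) * L * B₀) * (α₀ + α₁))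
    {U₀ U' : Site d → Fin d → 𝔸ˣ} (hU₀ : ∀ x κ, U₀ x κ ∈ unitaryUnits 𝔸)
    (h33 : InAk L k η α₀ Ω U₀) (h34 : InAk L k η α₀ Ω (mulCfg U' U₀)) (hAx : ∀ m', m' ≤ k → InAxZ L m' (Λs m') U₀ (mulCfg U' U₀))
    -- the base datum
    {A : Site d → Fin d → 𝔸}
    (hdat : ∀ j, j ≤ 0 → ∀ b ∈ {b : Site d × Fin d | SideTouches (Ω j) b.1 b.2},
      U' b.1 b.2 = cfgExp η A b.1 b.2 ∧ IsSelfAdjoint (A b.1 b.2) ∧ ‖A b.1 b.2‖ ≤ cs * ((L : ℝ) ^ j * η)⁻¹)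
    -- the [4] LETTERS at `(1, U₀)`, displayed as the JOIN reads them
    (g Δ : (Site d → 𝔸) →ₗ[ℂ] (Site d → 𝔸)) (q : (Site d → 𝔸) →ₗ[ℂ] (ℕ → Site d → 𝔸)) (qs : (ℕ → Site d → 𝔸) →ₗ[ℂ] (Site d → 𝔸))
    (Aw c : (ℕ → Site d → 𝔸) →ₗ[ℂ] (ℕ → Site d → 𝔸))
    (g_rightΩ : ∀ x, ∀ y ∈ Ω 0, (Δ (g x) + qs (Aw (q (g x)))) y = x y)
    (c_range : ∀ f, q (g (g (qs (c (q f))))) = q f)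
    (hΔ : ∀ (f : Site d → 𝔸), ∀ x ∈ Ω 0, Δ f x = covLap η U₀ ((Ω 0).indicator f) x)
    (hqs : ∀ (μ : ℕ → Site d → 𝔸), ∀ x ∈ Ω 0, qs μ x = QTZ L 1 (Λs 1) U₀ μ x)
    (hq : ∀ (f : Site d → 𝔸) (j : ℕ), j ≤ 1 → ∀ y ∈ Λs 1 j, q f j y = QprimeIter (zdBlockingZ d L) (bgTZ L U₀) j f y)
    (H' : XSpace d 1 𝔸 →ₗ[ℂ] (Site d → 𝔸)) {B₀'H B₂' BG BR : ℝ} (hB₀'H : 0 < B₀'H) (hB₂' : 0 ≤ B₂') (hBG : 0 ≤ BG) (hBR : 0 ≤ BR)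
    (hH0 : ∀ (X : XSpace d 1 𝔸) (x : Site d), ‖H' X x‖ ≤ B₀'H * ‖X‖)
    (hH1 : ∀ j, j ≤ 1 → ∀ (X : XSpace d 1 𝔸), ∀ p ∈ {b : Site d × Fin d | SideTouches (Ω j) b.1 b.2},
      wt L η j * ‖covDerivFwd η U₀ p.2 (H' X) p.1‖ ≤ B₀'H * ‖X‖)
    (hH2 : ∀ X : XSpace d 1 𝔸, Bd2 L η 1 Ω (covLap η U₀ (H' X)) (B₂' * ‖X‖))
    (hHsupp : ∀ (X : XSpace d 1 𝔸) (x : Site d), x ∉ Ω 0 → H' X x = 0)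
    (hHequiv : ∀ X Y : XSpace d 1 𝔸, (∀ p, Y p = -star (X p)) → ∀ x, H' Y x = -star (H' X x))
    (hQH : ∀ (Y : XSpace d 1 𝔸) (j : ℕ) (hj : j ≤ 1) (y : Site d), y ∈ Λs 1 j →
      QprimeIter (zdBlockingZ d L) (bgTZ L U₀) j (H' Y) y = Y (⟨j, Nat.lt_succ_of_le hj⟩, y))
    (hG : ∀ (f : Site d → 𝔸) (r : ℝ), 0 ≤ r → Bd2 L η 1 Ω f r →
      (∀ x, ‖g f x‖ ≤ BG * r) ∧ ∀ j, j ≤ 1 → ∀ p ∈ {b : Site d × Fin d | SideTouches (Ω j) b.1 b.2},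
        wt L η j * ‖covDerivFwd η U₀ p.2 (g f) p.1‖ ≤ BG * r)
    (hGsupp : ∀ (f : Site d → 𝔸) (x : Site d), x ∉ Ω 0 → g f x = 0)
    (hGreal : ∀ f : Site d → 𝔸, (∀ j, j ≤ 1 → ∀ x ∈ Ω j, IsSelfAdjoint (f x)) → ∀ x, IsSelfAdjoint (g f x))
    (hRbd : ∀ (f : Site d → 𝔸) (r : ℝ), 0 ≤ r → Bd2 L η 1 Ω f r → Bd2 L η 1 Ω (f - g (qs (c (q (g f))))) (BR * r))
    (hRreal : ∀ f : Site d → 𝔸, (∀ j, j ≤ 1 → ∀ x ∈ Ω j, IsSelfAdjoint (f x)) →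
      ∀ j, j ≤ 1 → ∀ x ∈ Ω j, IsSelfAdjoint ((f - g (qs (c (q (g f))))) x))
    -- the JOIN's scalar windows, one-for-one (`αP := α₀`, `α₄ := 8B₀′c⋆`; `cB cA cDA` free above their datum values, `cDA ≥ 2dL²c⋆` here)
    {cB cA cDA : ℝ} (hcBlo : L * cs ≤ cB) (hcAlo : L * cs ≤ cA) (hcDAlo : 2 * (d : ℝ) * (L : ℝ) ^ 2 * cs ≤ cDA)
    (hα3 : C0Z d * α₀ ≤ 1 / 3) (hα4 : 4 * α₀ ≤ c2' d L)
    (hsmall : Real.exp (4 * cZ d * α₀) * (1 + 2 * (131072 * ((d : ℝ) + 1) ^ 2) * (KZ d L) ^ 2 * cB) ≤ 2)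
    (hc₃ : KZ d L * cB ≤ c3 d L) (hsc : 1024 * (d : ℝ) * KZ d L * cB ≤ 1) (hα₃' : 20 * d * KZ d L * cB ≤ 1 / 200)
    (hs₁ : 200 * C6 d * (2 * α₄) ≤ 1) (hs₂ : 12000 * ((d : ℝ) + 1) * L * (2 * α₄) ≤ 1)
    (hs₃ : C4G d L * (α₀ + 20 * d * KZ d L * cB + 4 * (2 * α₄)) ≤ 1)
    (hs₄ : 1024 * ((d : ℝ) + 1) * ((d : ℝ) + 4) * L ^ 2 * α₀ ≤ 1) (hs₅ : 32 * ((d : ℝ) + 1) ^ 2 * C6 d * L ^ 2 * α₀ ≤ 1)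
    (hs₆ : 16 * d * C5' d * C6 d * (L : ℝ) ^ 2 * α₀ ≤ 1) (hs₇ : 8 * d * C6 d * L * α₀ ≤ 1)
    (hsm : 20 * d * KZ d L * cB + α₄ ≤ 1 / (4 * B₀'H * (2 * C2p d))) (hprod8 : 2 * C6 d * (20 * d * KZ d L * cB + 4 * α₄) ≤ 1 / 8)
    {hE hE₂ lE lE₂ : ℝ} (hE_def : hE = B₀'H * (C2p d * (20 * d * KZ d L * cB + α₄) * α₄)) (hE₂_def : hE₂ = B₂' * (C2p d * (20 * d * KZ d L * cB + α₄) * α₄))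
    (lE_def : lE = B₀'H * (4 * C2p d * (20 * d * KZ d L * cB + 2 * α₄))) (lE₂_def : lE₂ = B₂' * (4 * C2p d * (20 * d * KZ d L * cB + 2 * α₄)))
    (hcA' : cA ≤ 1 / 13) (ha₁' : α₄ / 4 + hE ≤ 1 / 24) (hb₁' : α₄ / 4 + hE ≤ 1 / 140) (hθ : 10 * (α₄ / 4 + hE) * BR ≤ 1 / 2)
    (h103 : BG * Mc d BR (α₄ / 4 + hE) cA hE₂ cDA ≤ α₄ / 4)
    (h106 : BG * Kc d BR (α₄ / 4 + hE) cA hE₂ cDA lE₂ (1 + lE) (1 + lE) ≤ 1 / 2) :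
    ∃ lam : Site d → 𝔸, (∀ x, IsSelfAdjoint (lam x)) ∧ (∀ x, x ∉ Ω 0 → lam x = 0) ∧
      (∀ j, j ≤ 1 → ∀ b ∈ {b : Site d × Fin d | SideTouches (Ω j) b.1 b.2},
        ‖lam b.1‖ ≤ α₄ ∧ ((L : ℝ) ^ j * η) * ‖covDerivFwd η U₀ b.2 lam b.1‖ ≤ α₄) ∧
      (∃ μ : ℕ → Site d → 𝔸, ∀ x ∈ Ω 0,
        covLap η U₀ ((Ω 0).indicator fun y => covDivB η U₀ A y + covLap η U₀ lam y +
          ((conjR (gaugeExp lam y)⁻¹ (covDivB η U₀ A y) - covDivB η U₀ A y) +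
            (gAd (covLap η U₀ lam y) (lam y) - covLap η U₀ lam y) + ∑ μ, frakF3 η U₀ lam A y μ)) x =
          QTZ L 1 (Λs 1) U₀ μ x) ∧
      Restr129Z L 1 (Λs 1) U₀ ((1 : Site d → 𝔸ˣ) * gaugeExp lam) := by
  subst hcs
  have hL1 : 1 ≤ L := by omega
  have hd1 : 1 ≤ d := le_trans (by norm_num) hd2
  have hLr : (1 : ℝ) ≤ L := by exact_mod_cast hL1
  have hk1 : 0 + 1 ≤ k := hk
  have hsum : 0 < α₀ + α₁ := add_pos hα₀ hα₁
  have hcs0 : 0 ≤ 5 * (d : ℝ) * L * B₀ * (α₀ + α₁) := by positivity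
  have hα₄pos : 0 < α₄ := by rw [hα₄]; positivity
  have hcB0 : 0 ≤ cB := (hcs0.trans (le_mul_of_one_le_left hcs0 hLr)).trans hcBlo
  have hcA0 : 0 ≤ cA := (hcs0.trans (le_mul_of_one_le_left hcs0 hLr)).trans hcAlo
  have hcDA0 : 0 ≤ cDA := le_trans (by positivity) hcDAlo
  have hαP2 : 2 * α₀ ≤ c2' d L := by linarith only [hα4, hα₀]
  -- the MASKED exponent `A′` of the base datum (globally Hermitian, `= A` on the sides touching `Ω₀`)
  obtain ⟨A', hsa, hagree, hWA, hA0⟩ := exists_masked_datum hdat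
  have hWA1 : ∀ j, j ≤ 0 → ∀ (y : Site d) (τ : Fin d), SideTouches (Ω j) y τ → U' y τ = cfgExp η A' y τ :=
    fun j hj y τ hs => (hWA j hj y τ hs).1
  have h41 : ∀ j, j ≤ 0 → ∀ (y : Site d) (τ : Fin d), SideTouches (Ω j) y τ →
      ‖A' y τ‖ ≤ (5 * (d : ℝ) * L * B₀ * (α₀ + α₁)) * ((L : ℝ) ^ j * η)⁻¹ := fun j hj y τ hs => (hWA j hj y τ hs).2
  -- the base datum `u₁ = 1`, `U₁ = U′`
  have hone : mgauge U₀ (1 : Site d → 𝔸ˣ) U' = U' := mgauge_one_eq U₀ U'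
  have hu1 : ∀ x, (1 : Site d → 𝔸ˣ) x ∈ unitaryUnits 𝔸 := fun _ => (unitaryUnits 𝔸).one_mem
  -- the JOIN's datum binders BY NAME (`B8Prop5SocketDatum` §7, §1; `restr129_one`)
  have h33' := h33_of_inAk (m := 0) hL1 hα₀ h33 hk1 htower
  have hP' := hP_of_datum (m := 0) hL1 hα₀ hΩ h34 hk1 htower hu1 hone hWA1
  have h69' : ∀ j, j ≤ 1 → ∀ y ∈ Λs 1 j, ∀ (x : Site d) (κ : Fin d), InBox (tlo L y j) (thi L y j) x →
      InBox (tlo L y j) (thi L y j) (x + e κ) → ‖iEta η A' x κ‖ ≤ cB * ((L : ℝ) ^ j)⁻¹ :=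
    fun j hj y hy x κ hx hxe =>
      (h69_of_datum (m := 0) hd2 hL1 hη hΩ htower hcs0 h41 j hj y hy x κ hx hxe).trans
        (mul_le_mul_of_nonneg_right hcBlo (by positivity))
  have hA' : ∀ j, j ≤ 1 → ∀ x ∈ Ω j, ∀ μ : Fin d,
      wt L η j * ‖A' x μ‖ ≤ cA ∧ wt L η j * ‖conjR (U₀ (x - e μ) μ)⁻¹ (A' (x - e μ) μ)‖ ≤ cA := fun j hj x hx μ =>
    ⟨(hA_of_datum (m := 0) hd2 hL1 hη hΩ hU₀ hcs0 h41 j hj x hx μ).1.trans hcAlo,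
      (hA_of_datum (m := 0) hd2 hL1 hη hΩ hU₀ hcs0 h41 j hj x hx μ).2.trans hcAlo⟩
  have hBu : ∀ (x : Site d) (κ : Fin d), expCfg (iEta η A') x κ ∈ unitaryUnits 𝔸 := expCfg_iEta_mem_unitaryUnits η hsa
  have hAx' : InAxZ L 1 (Λs 1) U₀ (mgauge U₀ 1 (expCfg (iEta η A')) * U₀) :=
    inAx_mgauge_expCfg_of_datum (m := 0) hd2 hLs hΩ htower hone hWA1 (hAx 1 hk)
  have h129' : Restr129Z L 1 (Λs 1) U₀ (1 : Site d → 𝔸ˣ) := B8Thm4TruncationLocalRec.restr129Z_one L 1 (Λs 1) U₀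
  -- the source `D*A′` from the weight-free gradient bound `η²|∇A′| ≤ 2c⋆`: `|D*A′|₍₋₂₎ ≤ d·L²·2c⋆ ≤ cDA` at one level; Hermitian
  have hgrad : ∀ j, j ≤ 0 → ∀ (y : Site d) (κ τ : Fin d), SideTouches (Ω j) y τ →
      ((L : ℝ) ^ j * η) ^ 2 * ‖covDerivFwd η U₀ κ (fun z => A' z τ) y‖ ≤ 2 * (5 * (d : ℝ) * L * B₀ * (α₀ + α₁)) := by
    intro j hj y κ τ _
    obtain rfl : j = 0 := Nat.le_zero.mp hj
    rw [pow_zero, one_mul]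
    exact grad_bound_trivial hη hL1 hU₀ hcs0 h41 hA0 y κ τ
  have hcDAlo' : (d : ℝ) * (L : ℝ) ^ 2 * (2 * (5 * (d : ℝ) * L * B₀ * (α₀ + α₁))) ≤ cDA := by
    have e : (d : ℝ) * (L : ℝ) ^ 2 * (2 * (5 * (d : ℝ) * L * B₀ * (α₀ + α₁))) = 2 * (d : ℝ) * (L : ℝ) ^ 2 * (5 * (d : ℝ) * L * B₀ * (α₀ + α₁)) := by
      ring
    rw [e]; exact hcDAlo
  have hDA : Bd2 L η 1 Ω (fun y => covDivB η U₀ A' y) cDA := fun j hj x hx =>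
    (bd2_covDivB_of_grad (m := 0) hd2 hL1 hη hΩ hU₀ (by positivity) hgrad j hj x hx).trans hcDAlo'
  have hDAsa : ∀ j, j ≤ 1 → ∀ x ∈ Ω j, IsSelfAdjoint (covDivB η U₀ A' x) := fun j _ x _ => isSelfAdjoint_covDivB hU₀ hsa x
  -- the JOIN's bond classes `Eb j := {b ∣ SideTouches (Ω j) b}` (§6)
  have hEbΩ : ∀ j, j ≤ 1 → ∀ x ∈ Ω j, ∀ μ : Fin d, (x, μ) ∈ {b : Site d × Fin d | SideTouches (Ω j) b.1 b.2} ∧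
      (x - e μ, μ) ∈ {b : Site d × Fin d | SideTouches (Ω j) b.1 b.2} := fun j _ x hx μ => sideTouches_pair_of_mem hd2 hx μ
  have hEbT : ∀ j, j ≤ 1 → ∀ y ∈ Λs 1 j, ∀ (x : Site d) (κ : Fin d), InBox (tlo L y j) (thi L y j) x →
      InBox (tlo L y j) (thi L y j) (x + e κ) → (x, κ) ∈ {b : Site d × Fin d | SideTouches (Ω j) b.1 b.2} :=
    fun j hj y hy x κ hx _ => sideTouches_of_tower_bond hd2 htower hj hy x κ hx
  -- THE JOIN WITH THE LAWS ON PRINT'S DOMAINS (`hFP_kLevel_of_sectE_local'_RD`, BY NAME) at `k := 1`, `Λs := Λs 1`, `u₁ := 1`, `B := iηA′`, `αP := α₀`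
  obtain ⟨lam, hlsa, hloff, h108, ⟨μ, hmul⟩, h129''⟩ := hFP_kLevel_of_sectE_local'_RD (k := 1) (Λs := Λs 1)
    (Eb := fun j => {b : Site d × Fin d | SideTouches (Ω j) b.1 b.2}) (u₁ := (1 : Site d → 𝔸ˣ)) (A := A') hLs hs1 hη hU₀ hEbΩ hEbT g Δ q qs
    Aw c g_rightΩ c_range hΔ hqs hq H' hα₀ hα3 hα4 hcB0 hα₄pos hB₀'H hB₂' h33' h69' hd1 hα₀ hα3 hαP2 hBu hP' hAx' h129' hH0 hH1
    hH2 hHsupp hHequiv hQH hsmall hc₃ hsc hα₃' hs₁ hs₂ hs₃ hs₄ hs₅ hs₆ hs₇ hsm hprod8 hE_def hE₂_def lE_def lE₂_def hBG hBR hcA0 hcA' hcDA0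
    ha₁' hb₁' hθ hG hGsupp hGreal hRbd hRreal hDA hDAsa hA' hsa h103 h106
  refine ⟨lam, hlsa, hloff, fun j hj b hb => h108 j hj b hb, ⟨μ, fun x hx => ?_⟩, h129''⟩
  -- transport the multiplier clause from `A′` back to `A`: the two agree on the bonds read on `Ω₀`
  have hind : ((Ω 0).indicator fun y => covDivB η U₀ A y + covLap η U₀ lam y +
        ((conjR (gaugeExp lam y)⁻¹ (covDivB η U₀ A y) - covDivB η U₀ A y) +
          (gAd (covLap η U₀ lam y) (lam y) - covLap η U₀ lam y) + ∑ μ, frakF3 η U₀ lam A y μ)) =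
      ((Ω 0).indicator fun y => covDivB η U₀ A' y + covLap η U₀ lam y +
        ((conjR (gaugeExp lam y)⁻¹ (covDivB η U₀ A' y) - covDivB η U₀ A' y) +
          (gAd (covLap η U₀ lam y) (lam y) - covLap η U₀ lam y) + ∑ μ, frakF3 η U₀ lam A' y μ)) := by
    refine Set.indicator_congr fun y hy => ?_
    have h₁ : ∀ ν : Fin d, A' y ν = A y ν := fun ν => hagree 0 le_rfl y ν (sideTouches_pair_of_mem hd2 hy ν).1
    have h₂ : ∀ ν : Fin d, A' (y - e ν) ν = A (y - e ν) ν := fun ν => hagree 0 le_rfl (y - e ν) ν (sideTouches_pair_of_mem hd2 hy ν).2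
    have h₃ : ∀ ν : Fin d, frakF3 η U₀ lam A' y ν = frakF3 η U₀ lam A y ν := fun ν => frakF3_congr_at η U₀ lam (h₁ ν) (h₂ ν)
    simp only [covDivB_congr_at η U₀ h₁ h₂, h₃]
  rw [hind]
  exact hmul x hx

end Base

end Literature.MathematicalPhysics.QuantumFieldTheory.Balaban1983to89.B8SockHFPRec

end
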